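import Literature.Probability.FitznerVanDerHofstad2017.BoundMapMonotone
import Literature.Probability.FitznerVanDerHofstad2017.F3Bounds

/-!
# Literature.Probability.FitznerVanDerHofstad2017.NoGoFrame — the typed frame of the d = 10 no-go certificate

CITATION HEADER (PLACEMENT v2). Part of the certified REPRODUCTION of R. Fitzner, R. van der Hofstad, *Mean-field
behavior for nearest-neighbor percolation in d > 10*, EJP 22 (2017) no. 43 [FvdH17] (with its Mathematica notebooks
`General.nb`, `Percolation.nb`, `SRW.nb`) and *Generalized approach to the non-backtracking lace expansion*, PTRF 169
(2017) 1041–1119 [NoBLE17]; build `lace`, seat lean1 (gen 3), node N28 / REFEREE R6.  This module carries NO verdict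
and NO numerical literal other than the two caps `7/10`, `1/8` inherited from `BoundMapMonotone.afUp_mono`; the
two-kernel verdict module (`MonotoneEscape`, PLACEMENT v5 / REFEREE C8) is a different file.

CELL REFERENCES.  "cell N" = the N-th input cell of `Percolation.nb` (the numbering of the transcript
`HOME/num1/engineA/Percolation.auto.py`); in brackets the line numbers of the published transcript
`HOME/b2b-lace-num3/published/Percolation.txt`, which `BetaMap.lean` quotes as `In[l]`: cell 1 [l.94–99: `Gamma1`,
`Gamma2`, `Gamma3=1`, `cmu`, the six `c`], cell 3 [l.171–175: `z[i]`, `z[o]`, `VarGamma2`], cells 3–43 = STAGE 1,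
cell 44 [l.1214–1237: `mu`, `mub`, `mumin`, the App. D calls], cell 45 [l.1267–1270: `TechCondition`], cell 46
[l.1286–1288: `boundF1`], cell 47 [l.1303: `boundF2`], cell 48 [l.1320–1333: `const`, `boundF3[j,i]`], cell 49 [l.1337:
`BoundFThreeBound`], cells 50–54 [l.1352–1424: `boundF3[j,o]`], cell 55 [l.1429 ff.: `BoundsF3Table`], cell 56
[l.1441–1444: `SuccesF`, `Succes`].  `General.nb` In[1]–[3] as in `BetaMap.lean` / `F3Bounds.lean`.

## What is typed and what is not

The d-dimensional NoBLE bootstrap "succeeds" iff some choice of constants `(Γ₁, Γ₂, Γ₃, c_μ, c₁, …, c₆)` makes the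
boolean `Succes[i] ∧ Succes[o]` of cell 56 true ([FvdH17] §2.5, EJP p. 16; [NoBLE17] Def. 2.9, PTRF p. 1060).  The
computation has three layers:

1. STAGE 1 (cells 3–43, ≈ 560 assignments: two-point-function, bubble and `Ξ/Ψ/Π`-coefficient bounds, incl. the
   `Eigensystem` tail cells): constants ↦ the sixty inputs of App. D at the two points `s ∈ {i, o}` plus the three
   `Bound[G,…,o]` values used by cells 51–54.  NOT typed here: it is the abstract map `Frame.S : State → Stage1` with
   its validity region `Frame.U` (where the series behind the cells converge), and everything the frame needs of it is
   the hypothesis record `Frame.Hyp` (`U` downward closed; fieldwise monotone, in the mixed-sign order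
   `BetaMap.Inputs.Dom`, below points of `U`; structural signs `BetaMap.Inputs.Nonneg` on `U`; the wiring identity
   `mu[s] = Γ₁/((2d−1)c_μ)` of cell 44; and the sign checks at the floor `0 ≤ m, Γ₁, Γ₂` and `0 ≤ 1 + β_Π̂(y₀,s)`).
2. APP. D (`General.nb` In[1] = [NoBLE17] (D.1)–(D.32), PTRF pp. 1110–1117): typed in `BetaMap.lean`, order
   properties in `BoundMapMonotone.lean` (and, for the two as-coded argument wirings, in § AsCoded below).
3. THE BOUNDS (`General.nb` In[2]–[3] = [NoBLE17] (3.61)–(3.87), PTRF pp. 1074–1079, typed in `F3Bounds.lean`) and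
   the WIRING of cells 44–56 (typed HERE, cell by cell: `Frame.part1`, `Frame.mlow`, `Frame.F2`, `Frame.argsWith`,
   `Frame.cells`, `Frame.initCell`, `Frame.T`, `Frame.Closes`).

WIRING VARIANTS (HOME/DIVERGENCE.md).  Three notebook/paper discrepancies live inside the typed layers and are
switches of the frame, so that every variant the engines run is an instance: `Frame.codedD20` (β̲_{ΔR,F} with the odd
aggregate twice, l.1237, vs (D.32) as printed), `Frame.codedD31` ((D.21) slot `XiDeltaR` unweighted, l.1233, vs
weighted as printed), `Frame.codedD33` (l.1337: slot `bRp` ← `β_{R,F}`, `bRf` ← `β_{R,Φ}`, vs the derivation's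
`bRp` ← `β_{R,Φ}`), and `Frame.printedD36` (initial-point cells with the exponent `1` of (3.31) as printed vs the
notebook's `n+1`); all theorems below hold for all sixteen settings.  The remaining variants (valid-K rule
D12/D16/D27, SRW-table corrections D7/D21) concern the tables `Frame.τ` and stage 1, over which the frame is already
parametric.
REFEREE R6 wording ("AS IMPLEMENTED in General.nb/Percolation.nb") is the setting `codedD20 = codedD31 = codedD33 = true`,
`printedD36 = false`.  `Frame.Closes` also carries the published standing conditions of the bootstrap ([NoBLE17] Lemma 2.1:
`Γ₁, Γ₂ > 1`; `c_μ > 0`: `m > 0`), so that the floor `(1, 0, 1, c₀ ≤ initCell)` lies below every closing tuple and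
`Frame.noGo_all_floor` concludes `¬ ∃ y, Closes y` from a discharged box cover alone.

## Coordinates and normalisations (HOME/MARGINS.md §6.1, HOME/DIVERGENCE.md D2)

* `Γ₃ = 1`: cell 1 sets `Gamma3=1`; only the products `Γ₃·c_j` enter stage 1 and cell 55/56 test
  `0 < max_j (boundF3[j,s]/c_j)·Γ₃ < Γ₃`, so `Γ₃` is a normalisation and the state carries the six weights `c_j`.
* `m` instead of `c_μ`: `c_μ` occurs in the notebook only in `mu[s] = Γ₁/((2d−1)c_μ) =: m` (cell 44, l.1214; the
  same value at both points) and in `boundF1[part2,s] = c_μ(1+β_Π̂)/(1−(2d/(2d−1))β_Ψ̂)` (cell 46, l.1287; [NoBLE17]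
  (3.5), PTRF pp. 1065–1066); in the coordinates `y = (Γ₁, m, Γ₂, c)` every stage-1 bound is non-decreasing in `y`,
  and `boundF1[part2,s] < Γ₁` reads `Frame.mlow y s < m` (`Frame.f1part2_iff`).  "A closing choice of constants" is
  `∃ y, Frame.Closes y`.
* `Frame.Closes` = the booleans of cells 45 and 56 at both points, each `boundF3` boolean rendered per cell as
  `boundF3[j,s] < c_j` (equivalent to the notebook's for positive weights), TechCondition II omitted (it is implied by
  `0 < boundF2[s]`, HOME/DIVERGENCE.md D6; omitting a conjunct only weakens `Closes`, i.e. strengthens the no-go),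
  TOGETHER WITH the standing hypotheses that the notebook does not test: `y ∈ U` (stage 1), and for App. D `m < 1`,
  `0 ≤ μ̲_p`, the geometric-series ratio `(2dμ̄_p/(1−μ_p))β_{Ξ^ι,abs} < 1` of (D.21)/(D.29)/(D.32), and
  `1 − (2d/(2d−1))β_Ψ̂ > 0` in (3.5) (HOME/DIVERGENCE.md D37, row "WF").  Outside this region the closed forms of stage 1
  and App. D are not bounds at all, and a `True` of cell 56 there certifies nothing.

## The theorems (REFEREE R6 (i)–(iii), HOME/MARGINS.md §5–§7)

`Frame.T` is the notebook map `y ↦ concluded bounds`; `Frame.T' AF` the MONOTONE MINORANT used by the numerics: the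
M3 patch of `F3Bounds` (`Max[|α̲_F−1|,|ᾱ_F−1|] ↦ max(ᾱ_F−1, 1−α̲_F, 0)`, `F3Bounds.boundFThreeMono`) and an admissible
evaluator `AF` of the slot `afmax = ᾱ_F` (`Frame.AFHyp`: the true `ᾱ_F` on boxes `m ≤ m₂ ≤ 7/10` when
`β̲_{ΣΠα}(y₀,o) ≤ 1/8` — `Frame.AFHyp_engine`; or the cap-free box minorant `BetaMap.afUpBoxOfInputs` for any `m₂ < 1`
— `Frame.AFHyp_box`).  `Frame.Adm m₂` is the downward-closed part of closing on the box `m ≤ m₂`.  Proved here, for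
every frame, every wiring setting and every floor `y₀` satisfying `Frame.Hyp y₀`:
(i) `T' AF` is monotone between comparable points of the cone above `y₀` whose upper point is admissible
(`Frame.T'_mono`); (ii) `T' AF ≤ T` at admissible points (`Frame.T'_le_T`); (iii) `Adm` is downward closed in the
cone (`Frame.adm_down`) and `Closes y → Adm y ∧ T y ≤ y` (`Frame.adm_of_closes`, `Frame.T_le_of_closes`); hence the
SUB-ITERATION NO-GO `Frame.noGo_box` (`Frame.noGo_box_engine`, `Frame.noGo_box_capfree`, `Frame.noGo_box_floor`): if a
chain `ys 0 = y₀`, `ys (j+1) ≤ T' AF (ys j)` — ANY lower estimates of the minorant's values, which is what outward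
rounded interval arithmetic certifies — stays above `y₀` and its `k`-th member is inadmissible, then NO `y ≥ y₀` with
`m ≤ m₂` closes.  All of `m ∈ [m(y₀), 1)` is covered by finitely many boxes, each with its own floor and chain
(`Frame.noGo_of_cover`; boxes near `m = 1` escape at `k = 0`: the geometric-series ratio fails at their floor),
and `Frame.noGo_all` adds floor dominance (every closing point lies above the global floor) to conclude `¬ ∃ y, Closes y`.
The order-theoretic core (`noGo_of_subiteration`) and the three lemmas of the carver seat's
`LaceExpansionHighD/NoGo.lean` (`iterate_le_of_map_le`, `noGo_of_monotone_escape`, `witness_of_iterate`, re-landed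
verbatim, credited) open the file; `noGo_of_monotone_escape` itself is not instantiated because the notebook map is
monotone only on the admissible cone.

Honest residue (HOME/GAPS.md N28): `Frame.Hyp` (stage 1) is discharged OUTSIDE the kernel — by the term-by-term
monotonicity audit HOME/MARGINS.md M1–M6, §9 (E1) and by the certified numerics (N29/N39: the floor `y₀`, the chain,
the escape, the floor sign checks, the cap `β̲_{ΣΠα}(y₀,o) ≤ 1/8` or the box minorant, one run per box).  No facts, no
`sorry`; every statement is [folklore]-tagged bookkeeping about the cited cells and formulas.

[cite: FitznerVanDerHofstad2017, §2.5, EJP p. 16; §2.7, EJP p. 18; notebook Percolation.nb cells 1, 3, 44–56 (published transcript l.94–99, 171–175, 1214–1444); notebook General.nb In[1]–[3]]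
[cite: FitznerVanDerHofstad2016NoBLE, Def. 2.9, PTRF p. 1060; Assumption 2.7, PTRF pp. 1059–1060; (3.5), (3.9), PTRF pp. 1065–1066; §3.3.5 (3.61)–(3.87), PTRF pp. 1074–1079; App. D (D.1)–(D.32), PTRF pp. 1110–1117]
-/

noncomputable section

namespace Literature.Probability.FitznerVanDerHofstad2017
namespace NoGoFrame

open BetaMap F3Bounds Literature.Barriers.CriticalPhenomena

/-! ## The order-theoretic core -/

section Core

variable {α : Type*} [Preorder α]

/-- Iterates of a monotone map from a point below a super-fixed-point stay below it (carver seat,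
`LaceExpansionHighD/NoGo.lean`, verbatim). [folklore] -/
theorem iterate_le_of_map_le {T : α → α} (hT : Monotone T) {x₀ x : α} (h₀ : x₀ ≤ x)
    (hx : T x ≤ x) (k : ℕ) : T^[k] x₀ ≤ x := by
  induction k with
  | zero => simpa using h₀
  | succ k ih =>
    rw [Function.iterate_succ_apply']
    exact (hT ih).trans hx

/-- NO-GO by monotone escape for a GLOBALLY monotone map (carver seat, `LaceExpansionHighD/NoGo.lean`, verbatim):
if `Adm` is downward closed and the `k`-th iterate of `x₀` is inadmissible, no admissible `x ≥ x₀` has `T x ≤ x`.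
The notebook map is monotone only on the admissible cone, whence the sub-iteration form below. [folklore] -/
theorem noGo_of_monotone_escape {T : α → α} (hT : Monotone T) {Adm : α → Prop}
    (hAdm : ∀ ⦃x y : α⦄, x ≤ y → Adm y → Adm x) {x₀ : α} {k : ℕ} (hk : ¬ Adm (T^[k] x₀)) :
    ¬ ∃ x, x₀ ≤ x ∧ Adm x ∧ T x ≤ x := by
  rintro ⟨x, h₀, hAx, hTx⟩
  exact hk (hAdm (iterate_le_of_map_le hT h₀ hTx k) hAx)

/-- The positive use of the same iteration (carver seat, verbatim): an admissible super-fixed iterate is a witness.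
[folklore] -/
theorem witness_of_iterate {T : α → α} {Adm : α → Prop} {x₀ : α} {k : ℕ}
    (hle : x₀ ≤ T^[k] x₀) (hAdm : Adm (T^[k] x₀)) (hfix : T (T^[k] x₀) ≤ T^[k] x₀) :
    ∃ x, x₀ ≤ x ∧ Adm x ∧ T x ≤ x :=
  ⟨T^[k] x₀, hle, hAdm, hfix⟩

/-- **SUB-ITERATION NO-GO.**  `T` is the true map, `T'` a minorant of it on admissible points which is monotone between
comparable points of the cone above `y₀` whose upper point is admissible; `Adm` is downward closed in the cone and every
closing point is admissible with `T y ≤ y`.  If a chain `ys` with `ys 0 = y₀`, `ys (j+1) ≤ T' (ys j)` (lower estimates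
suffice) stays in the cone and `ys k` is inadmissible, then nothing in the cone closes.  (Induction: `ys j ≤ y` for
every closing `y`.) [folklore] -/
theorem noGo_of_subiteration {T T' : α → α} {Adm Cl : α → Prop} {y₀ : α} {ys : ℕ → α} {k : ℕ}
    (hmono : ∀ ⦃x y⦄, y₀ ≤ x → x ≤ y → Adm y → T' x ≤ T' y)
    (hmin : ∀ ⦃y⦄, y₀ ≤ y → Adm y → T' y ≤ T y)
    (hdown : ∀ ⦃x y⦄, y₀ ≤ x → x ≤ y → Adm y → Adm x)
    (hcl : ∀ ⦃y⦄, y₀ ≤ y → Cl y → Adm y ∧ T y ≤ y)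
    (h0 : ys 0 = y₀) (hstep : ∀ j < k, ys (j+1) ≤ T' (ys j)) (hfl : ∀ j ≤ k, y₀ ≤ ys j)
    (hesc : ¬ Adm (ys k)) :
    ¬ ∃ y, y₀ ≤ y ∧ Cl y := by
  rintro ⟨y, hy₀, hy⟩
  obtain ⟨hA, hT⟩ := hcl hy₀ hy
  have key : ∀ j ≤ k, ys j ≤ y := by
    intro j hj
    induction j with
    | zero => simpa [h0] using hy₀
    | succ j ih =>
      have hj' : j < k := Nat.lt_of_succ_le hj
      calc ys (j+1) ≤ T' (ys j) := hstep j hj'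
        _ ≤ T' y := hmono (hfl j hj'.le) (ih hj'.le) hA
        _ ≤ T y := hmin hy₀ hA
        _ ≤ y := hT
  exact hesc (hdown (hfl k le_rfl) (key k le_rfl) hA)

end Core

/-! ## The state space `y = (Γ₁, m, Γ₂, c₁, …, c₆)` -/

/-- The state of the d-dimensional bootstrap in monotone coordinates: `Γ₁`, `m = Γ₁/((2d−1)c_μ)` (the value the
notebook assigns to `mu[s]`, cell 44, l.1214), `Γ₂`, and the six `f₃`-weights `c_j = c_{n,l,S}` of cells 1 and 48
(with `Γ₃ = 1`). [cite: FitznerVanDerHofstad2017, notebook Percolation.nb cells 1, 44, 48 (transcript l.94–99, 1214, 1320–1325)] -/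
structure State where
  /-- `Γ₁` -/
  Gamma1 : ℝ
  /-- `m = Γ₁/((2d−1)c_μ)` = `mu[s]` of cell 44 -/
  m : ℝ
  /-- `Γ₂` -/
  Gamma2 : ℝ
  /-- the weights `c_j`, `j = 1..6` ↦ `Fin 6` -/
  c : Fin 6 → ℝ

namespace State

/-- The componentwise (information) order on states. [folklore] -/
instance : LE State := ⟨fun x y => x.Gamma1 ≤ y.Gamma1 ∧ x.m ≤ y.m ∧ x.Gamma2 ≤ y.Gamma2 ∧ x.c ≤ y.c⟩

/-- The componentwise order. [folklore] -/
theorem le_def {x y : State} : x ≤ y ↔ x.Gamma1 ≤ y.Gamma1 ∧ x.m ≤ y.m ∧ x.Gamma2 ≤ y.Gamma2 ∧ x.c ≤ y.c :=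
  Iff.rfl

/-- The componentwise order is a preorder. [folklore] -/
instance : Preorder State where
  le_refl x := ⟨le_rfl, le_rfl, le_rfl, le_rfl⟩
  le_trans x y z h₁ h₂ :=
    ⟨h₁.1.trans h₂.1, h₁.2.1.trans h₂.2.1, h₁.2.2.1.trans h₂.2.2.1, h₁.2.2.2.trans h₂.2.2.2⟩

end State

/-- The two evaluation points of the bootstrap: `i` = the initial point `z_I`, `o` = a general `p < p_c` (the index
`s` of `Do[…, {s,{i,o}}]`, cells 3 and 44). [cite: FitznerVanDerHofstad2017, notebook Percolation.nb cells 3, 44 (transcript l.171–175, 1214–1237)] -/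
inductive Pt | i | o
  deriving DecidableEq

/-- The OUTPUT of stage 1 at a state: the App. D input record at both points and the three two-point-function bounds
`Bound[G,{1},1,o]`, `Bound[G,{2},2,o]`, `Bound[G,{0,1},2,o]` used by cells 51–54.
[cite: FitznerVanDerHofstad2017, notebook Percolation.nb cells 3–43 (transcript l.171–1213)] -/
structure Stage1 where
  /-- the sixty App. D inputs at `s` -/
  inp : Pt → Inputs
  /-- `Bound[G,{1},1,o]` -/
  G11 : ℝ
  /-- `Bound[G,{2},2,o]` -/
  G22 : ℝ
  /-- `Bound[G,{0,1},2,o]` -/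
  G012 : ℝ

/-- The information order on stage-1 outputs. [folklore] -/
structure Stage1.Dom (a b : Stage1) : Prop where
  inp : ∀ s, (a.inp s).Dom (b.inp s)
  G11 : a.G11 ≤ b.G11
  G22 : a.G22 ≤ b.G22
  G012 : a.G012 ≤ b.G012

/-- The structural signs of stage-1 outputs. [folklore] -/
structure Stage1.Nonneg (a : Stage1) : Prop where
  inp : ∀ s, (a.inp s).Nonneg
  G11 : 0 ≤ a.G11
  G22 : 0 ≤ a.G22
  G012 : 0 ≤ a.G012

/-- A FRAME: the static data of the d-dimensional computation — the (real) dimension, the SRW tables of `SRW.nb`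
(`F3Bounds.Tables` over a type `ν` of lattice points), the boolean `ValueQ[T[2,0,{3}]]` of cells 51/54, the four
variant switches, the seven lattice points `{0}, {1}, {2}, {3}, {0,1}, {1,1}, {0,0,1}` named in cells 48–54, and the
stage-1 map with its validity region. [cite: FitznerVanDerHofstad2017, notebook Percolation.nb cells 3, 44, 48–54 (transcript l.171–175, 1214–1424)] -/
structure Frame (ν : Type*) where
  /-- dimension -/
  d : ℝ
  /-- SRW tables -/
  τ : Tables ν
  /-- `ValueQ[T[2,0,{3}]]` -/
  hasT203 : Bool
  /-- HOME/DIVERGENCE.md D20 (lean2): `true` = `β̲_{ΔR,F}` wired as `Percolation.nb` l.1237 (the odd aggregate in both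
  `XiIotaDeltaZero{Odd,Even}` slots: `BetaMap.nobleBetaOfInputsAsCoded`); `false` = (D.32) as printed
  (`BetaMap.nobleBetaOfInputs`). -/
  codedD20 : Bool
  /-- HOME/DIVERGENCE.md D31: `true` = the (D.21) slot `XiDeltaR` unweighted as l.1233 (`BetaMap.extraOfInputsAsCoded`,
  component 3); `false` = weighted as printed (`BetaMap.extraOfInputs`). -/
  codedD31 : Bool
  /-- HOME/DIVERGENCE.md D33: `true` = the positional wiring of cell 49, l.1337 (slot `bRp` ← `β_{R,F}`, `bRf` ← `β_{R,Φ}`);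
  `false` = the derivation's ([NoBLE17] (3.64): slot `bRp` ← `β_{R,Φ}`, `bRf` ← `β_{R,F}`). -/
  codedD33 : Bool
  /-- HOME/DIVERGENCE.md D36(b): `true` = the initial-point cells with the exponent of [NoBLE17] (3.31) AS PRINTED
  (`F3Bounds.boundFThreeInitialPrinted`, exponent `1`: the "print-only" variant); `false` = the notebook's
  `BoundFThreeInital` (exponent `n+1`, `F3Bounds.boundFThreeInitial`). -/
  printedD36 : Bool
  /-- the point `{0}` -/
  n0 : ν
  /-- `{1}` -/
  n1 : ν
  /-- `{2}` -/
  n2 : ν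
  /-- `{3}` -/
  n3 : ν
  /-- `{0,1}` -/
  n01 : ν
  /-- `{1,1}` -/
  n11 : ν
  /-- `{0,0,1}` -/
  n001 : ν
  /-- stage 1 -/
  S : State → Stage1
  /-- the STAGE-1 VALIDITY REGION: the states at which the closed forms of cells 3–43 are the bounds that [FvdH17]
  §§4–6 derive and move in their declared directions.  Its content is INSTANCE-SPECIFIC: for the full notebook map it
  includes the convergence of every scalar and matrix geometric series summed there (`ρ(B[s]) < 1` for the
  `Eigensystem` tails, HOME/MARGINS.md §9 (E1), HOME/DIVERGENCE.md D29); for the tail-free instance `T″₀` typed in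
  `Stage1Frame.lean` (`Stage1Cells.Data.frame`, no eigen block) it is `Stage1Cells.Data.U` = at both points the two
  geometric ratios `Bound[G,{1},3,s]`, `Bound[OpenBubble,1,s] < 1` and the five maximal bracket arguments of the
  product lower bounds of cells 36–37 `≤ 1` (SCOPE NOTE of `Stage1Frame.lean`; numerically `≤ 0.144` resp. `≤ 0.089`
  at the `d = 11` certificate tuple and along every `d = 10` floor chain incl. the escape iterates, HOME/MARGINS.md §16).
  Why `Frame.Closes` may REQUIRE `y ∈ U` (REFEREE2 ref2-R7): the series conditions cost nothing — off them the
  `N`-sums of [FvdH17, ext. App. C] behind these cells are `+∞` (entrywise positive vectors: HOME/MARGINS.md §9.3(v);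
  in the tree `EigenTails.not_neumannDom_of_subharmonic`), so no tuple closes the PRINTED bounds there; the bracket
  conditions of the `T″₀` instance are a genuine (remote) restriction of scope, stated as such in `Stage1Frame.lean`.
  In this file `U` is abstract: constrained only through `Frame.Hyp` (downward closed in the cone) and required by
  `Frame.Closes` / `Frame.Adm`. -/
  U : State → Prop

namespace Frame

section Defs

variable {ν : Type*} (Φ : Frame ν)

/-! ## The wiring, `Percolation.nb` cells 44–56 -/

/-- `2d/(2d−1)`, the factor in cell 46 ((3.5)). [cite: FitznerVanDerHofstad2017, notebook Percolation.nb cell 46 (transcript l.1286–1287)] [cite: FitznerVanDerHofstad2016NoBLE, (3.5), PTRF pp. 1065–1066] -/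
def kap : ℝ := 2 * Φ.d / (2 * Φ.d - 1)

/-- The App. D outputs at state `y`, point `s` (cell 44 = `nobleBetaOfInputs`; `βΔ` is superseded by `deltaAt`). [cite: FitznerVanDerHofstad2017, notebook Percolation.nb cell 44 (transcript l.1217–1237)] -/
abbrev betaAt (y : State) (s : Pt) : NobleBeta := nobleBetaOfInputs Φ.d ((Φ.S y).inp s)

/-- The five extra App. D outputs at `y`, `s` (cell 44 = `extraOfInputs`: `c̲_Φ, ᾱ_F, β_{R,F}, β_{ΔR,Φ}, β_{|ΔR,F|}`;
component 3 is superseded by `rpDeltaAt`). [cite: FitznerVanDerHofstad2017, notebook Percolation.nb cell 44 (transcript l.1217–1237)] -/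
abbrev exAt (y : State) (s : Pt) : Fin 5 → ℝ := extraOfInputs Φ.d ((Φ.S y).inp s)

/-- `β_Δ = −beta[Rf,Lower,Delta,s]` at `y`, `s`, in the wiring selected by `codedD20`. [cite: FitznerVanDerHofstad2017, notebook Percolation.nb cell 44 (transcript l.1237)] [cite: FitznerVanDerHofstad2016NoBLE, (D.32), PTRF p. 1117] -/
def deltaAt (y : State) (s : Pt) : ℝ :=
  if Φ.codedD20 then (nobleBetaOfInputsAsCoded Φ.d ((Φ.S y).inp s)).βΔ else (Φ.betaAt y s).βΔ

/-- `beta[Rp,Delta,s]` (`β_{ΔR,Φ}`) at `y`, `s`, in the wiring selected by `codedD31`. [cite: FitznerVanDerHofstad2017, notebook Percolation.nb cell 44 (transcript l.1233)] [cite: FitznerVanDerHofstad2016NoBLE, (D.21), PTRF p. 1114] -/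
def rpDeltaAt (y : State) (s : Pt) : ℝ :=
  if Φ.codedD31 then extraOfInputsAsCoded Φ.d ((Φ.S y).inp s) 3 else Φ.exAt y s 3

/-- The value received by `General.nb`'s slot `bRp` of `BoundFThree` (wiring selected by `codedD33`). [cite: FitznerVanDerHofstad2017, notebook Percolation.nb cell 49 (transcript l.1337); notebook General.nb In[3]] -/
def bRpSlot (y : State) : ℝ := if Φ.codedD33 then Φ.exAt y Pt.o 2 else (Φ.betaAt y Pt.o).βRΦ

/-- The value received by `General.nb`'s slot `bRf` of `BoundFThree` (wiring selected by `codedD33`; the slot is unused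
by `BoundH[1..5]`). [cite: FitznerVanDerHofstad2017, notebook Percolation.nb cell 49 (transcript l.1337); notebook General.nb In[3]] -/
def bRfSlot (y : State) : ℝ := if Φ.codedD33 then (Φ.betaAt y Pt.o).βRΦ else Φ.exAt y Pt.o 2

/-- The geometric-series ratio `(2d·mub/(1−mu))·Bound[XiIota,Absolut,s]` of (D.21)/(D.29)/(D.32) as wired. [cite: FitznerVanDerHofstad2017, notebook Percolation.nb cell 44 (transcript l.1233–1237)] [cite: FitznerVanDerHofstad2016NoBLE, (D.21), (D.29), (D.32), PTRF pp. 1114–1117] -/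
def tmp2At (y : State) (s : Pt) : ℝ :=
  2 * Φ.d * ((Φ.S y).inp s).mub / (1 - ((Φ.S y).inp s).mu) * ((Φ.S y).inp s).xiIotaAbs

/-- Cell 45 `TechCondition[I,s]` quantity `beta[CPhi,Lower,s] − beta[ap,s] − beta[Rp,s]` (must be `> 0`). [cite: FitznerVanDerHofstad2017, notebook Percolation.nb cell 45 (transcript l.1267)] -/
def techI (y : State) (s : Pt) : ℝ := Φ.exAt y s 0 - (Φ.betaAt y s).βαΦ - (Φ.betaAt y s).βRΦ

/-- Cell 45 `TechCondition[III,s]` quantity `((2d−1)mub/(1−mu))·Bound[XiIota,Absolut,s]` (must be `< 1`). [cite: FitznerVanDerHofstad2017, notebook Percolation.nb cell 45 (transcript l.1269)] -/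
def techIII (y : State) (s : Pt) : ℝ :=
  (2 * Φ.d - 1) * ((Φ.S y).inp s).mub / (1 - ((Φ.S y).inp s).mu) * ((Φ.S y).inp s).xiIotaAbs

/-- Cell 47 denominator `beta[af,Lower,s] + beta[Rf,Lower,Delta,s]` = `α̲_F − β_Δ` ((3.9); `β_Δ` in the selected wiring). [cite: FitznerVanDerHofstad2017, notebook Percolation.nb cell 47 (transcript l.1303)] [cite: FitznerVanDerHofstad2016NoBLE, (3.9), PTRF p. 1066] -/
def den2 (y : State) (s : Pt) : ℝ := (Φ.betaAt y s).αFlow - Φ.deltaAt y s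

/-- Cell 47 numerator `beta[CPhi,Upper,s] + beta[ap,s] + beta[Rp,s]` ((3.9)). [cite: FitznerVanDerHofstad2017, notebook Percolation.nb cell 47 (transcript l.1303)] [cite: FitznerVanDerHofstad2016NoBLE, (3.9), PTRF p. 1066] -/
def num2 (y : State) (s : Pt) : ℝ := (Φ.betaAt y s).cΦup + (Φ.betaAt y s).βαΦ + (Φ.betaAt y s).βRΦ

/-- Cell 46 `boundF1[part1,s] = mubOverMu[s](1+beta[PiHat,s])/(1 − (2d/(2d−1)) beta[PsiHat,s])` ((3.5)). [cite: FitznerVanDerHofstad2017, notebook Percolation.nb cell 46 (transcript l.1286)] [cite: FitznerVanDerHofstad2016NoBLE, (3.5), PTRF pp. 1065–1066] -/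
def part1 (y : State) (s : Pt) : ℝ :=
  ((Φ.S y).inp s).mubOverMu * (1 + (Φ.betaAt y s).βPi) / (1 - Φ.kap * (Φ.betaAt y s).βΨ)

/-- Cell 46 `boundF1[part2,s] < Γ₁` in the coordinate `m`: the lower bound `(1+beta[PiHat,s])/((2d−1)(1 − κ beta[PsiHat,s]))`
that `m` must exceed (`f1part2_iff`). [cite: FitznerVanDerHofstad2017, notebook Percolation.nb cell 46 (transcript l.1287)] [cite: FitznerVanDerHofstad2016NoBLE, (3.5), PTRF pp. 1065–1066] -/
def mlow (y : State) (s : Pt) : ℝ :=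
  (1 + (Φ.betaAt y s).βPi) / ((2 * Φ.d - 1) * (1 - Φ.kap * (Φ.betaAt y s).βΨ))

/-- Cell 47 `boundF2[s] = ((2d−1)/(2d−2))·(num/den)` ((3.9)). [cite: FitznerVanDerHofstad2017, notebook Percolation.nb cell 47 (transcript l.1303)] [cite: FitznerVanDerHofstad2016NoBLE, (3.9), PTRF p. 1066] -/
def F2 (y : State) (s : Pt) : ℝ := (2 * Φ.d - 1) / (2 * Φ.d - 2) * (Φ.num2 y s / Φ.den2 y s)

/-- Cell 49 `BoundFThreeBound`: the `F3Bounds.Args` record at `y` (point `o`) with a given value for the `afmax` slot.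
NOTE the notebook's positional wiring (HOME/DIVERGENCE.md D33): `General.nb`'s formal slots are
`(…, ap, bRf, bRp, bRfDelta, bRpDelta, K̲)` and cell 49 passes `(…, beta[ap,o], beta[Rp,o], beta[Rf,o], beta[Rf,abs,Delta,o],
beta[Rp,Delta,o], 1/(beta[af,Lower,o]+beta[Rf,Lower,Delta,o]))`, so slot `bRf` receives `β_{R,Φ}` and slot `bRp` receives
`β_{R,F}`; `codedD33 = true` reproduces this, `false` wires the derivation's constants (`bRpSlot`/`bRfSlot`).  The slots
`bRpDelta` and `K̲` follow `codedD31` / `codedD20` (`rpDeltaAt`, `den2`). [cite: FitznerVanDerHofstad2017, notebook Percolation.nb cell 49 (transcript l.1337); notebook General.nb In[3]] [cite: FitznerVanDerHofstad2016NoBLE, (3.64), (3.87), PTRF pp. 1075–1079] -/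
def argsWith (y : State) (afmax : ℝ) : Args where
  Gamma2dash := (2 * Φ.d - 2) / (2 * Φ.d - 1) * y.Gamma2
  cp := (Φ.betaAt y Pt.o).cΦup
  afmin := (Φ.betaAt y Pt.o).αFlow
  afmax := afmax
  ap := (Φ.betaAt y Pt.o).βαΦ
  bRf := Φ.bRfSlot y
  bRp := Φ.bRpSlot y
  bRfDelta := Φ.exAt y Pt.o 4
  bRpDelta := Φ.rpDeltaAt y Pt.o
  Kunderline := 1 / Φ.den2 y Pt.o

/-- `z[o] = Γ₁/(2d−1)` (cell 3, l.172). [cite: FitznerVanDerHofstad2017, notebook Percolation.nb cell 3 (transcript l.172)] -/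
def zo (y : State) : ℝ := y.Gamma1 / (2 * Φ.d - 1)

/-- The `ValueQ[T[2,0,{3}]]` branch of cells 51/54: `B(n,l,{{3},{1,1},{0,0,1}})` if the table entry exists, else
`B(n,l,{{2},{0,1}})`. [cite: FitznerVanDerHofstad2017, notebook Percolation.nb cells 51, 54 (transcript l.1370, 1424)] -/
def bIf (B : ℕ → ℕ → ν → List ν → ℝ) (n l : ℕ) : ℝ :=
  if Φ.hasT203 then B n l Φ.n3 [Φ.n11, Φ.n001] else B n l Φ.n2 [Φ.n01]

/-- Cell 53 `tmpNeighborContributionOneD = (2d z[o]) B(1,2,{{1}}) + (1/(2d))((2d−2)·2·Bound[G,{2},2,o] + 4 Bound[G,{0,1},2,o])`. [cite: FitznerVanDerHofstad2017, notebook Percolation.nb cell 53 (transcript l.1408)] -/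
def tmpN (B : ℕ → ℕ → ν → List ν → ℝ) (G22 G012 z : ℝ) : ℝ :=
  2 * Φ.d * z * B 1 2 Φ.n1 [] + 1 / (2 * Φ.d) * ((2 * Φ.d - 2) * 2 * G22 + 4 * G012)

/-- Cells 50–54: the six cells `boundF3[j,o]` as a function of the inner evaluator `B(n,l,vecs)` (`BoundFThreeBound`),
the three `Bound[G,…,o]` values and `z[o]`; index `j : Fin 6` ↦ notebook `j+1`. [cite: FitznerVanDerHofstad2017, notebook Percolation.nb cells 50–54 (transcript l.1352–1424)] [cite: FitznerVanDerHofstad2016NoBLE, (3.87), PTRF p. 1079] -/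
def cells (B : ℕ → ℕ → ν → List ν → ℝ) (G11 G22 G012 z : ℝ) : Fin 6 → ℝ :=
  ![ min (B 1 6 Φ.n0 []) (B 1 5 Φ.n1 []),
     max G11 (max (2 * G22) (max (4 * G012) (Φ.bIf B 0 0))),
     max (2 * Φ.d * z * Φ.tmpN B G22 G012 z + G11)
       (max (B 1 1 Φ.n2 [] + 2 * G22) (max (B 1 1 Φ.n01 [] + 2 * G012) (Φ.bIf B 1 0))),
     max (Φ.tmpN B G22 G012 z) (B 1 1 Φ.n01 [Φ.n2]),
     B 1 2 Φ.n1 [Φ.n01, Φ.n2],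
     B 1 3 Φ.n1 [Φ.n01, Φ.n2] ]

/-- One initial-point cell `BoundFThreeInital(d,n,l,1,vecs)` in the variant selected by `printedD36`.
[cite: FitznerVanDerHofstad2017, notebook Percolation.nb cell 48 (transcript l.1328–1333); notebook General.nb In[3]] [cite: FitznerVanDerHofstad2016NoBLE, (3.31), PTRF p. 1070] -/
def initAt (n l : ℕ) (v₀ : ν) (vs : List ν) : ℝ :=
  if Φ.printedD36 then boundFThreeInitialPrinted Φ.τ Φ.d n l 1 v₀ vs else boundFThreeInitial Φ.τ Φ.d n l 1 v₀ vs

/-- Cell 48: the six initial-point cells `boundF3[j,i] = BoundFThreeInital(d,n,l,1,vecs)`. [cite: FitznerVanDerHofstad2017, notebook Percolation.nb cell 48 (transcript l.1328–1333); notebook General.nb In[3]] -/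
def initCell : Fin 6 → ℝ :=
  ![ Φ.initAt 1 6 Φ.n0 [],
     Φ.initAt 0 0 Φ.n1 [Φ.n2, Φ.n01],
     Φ.initAt 1 0 Φ.n1 [Φ.n2, Φ.n01],
     Φ.initAt 1 1 Φ.n1 [Φ.n2, Φ.n01],
     Φ.initAt 1 2 Φ.n1 [Φ.n2, Φ.n01],
     Φ.initAt 1 3 Φ.n1 [Φ.n2, Φ.n01] ]

/-- The cells at `o` as the notebook computes them (`BoundFThree` with the true `ᾱ_F`). [cite: FitznerVanDerHofstad2017, notebook Percolation.nb cells 49–54 (transcript l.1337–1424)] -/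
def cellT (y : State) : Fin 6 → ℝ :=
  Φ.cells (fun n l v vs => boundFThree Φ.τ n l v vs (Φ.argsWith y (Φ.exAt y Pt.o 1)))
    (Φ.S y).G11 (Φ.S y).G22 (Φ.S y).G012 (Φ.zo y)

/-- The cells at `o` of the MINORANT: `boundFThreeMono` (M3 patch) with the `afmax` slot filled by `AF y`. [folklore] -/
def cellT' (AF : State → ℝ) (y : State) : Fin 6 → ℝ :=
  Φ.cells (fun n l v vs => boundFThreeMono Φ.τ n l v vs (Φ.argsWith y (AF y)))
    (Φ.S y).G11 (Φ.S y).G22 (Φ.S y).G012 (Φ.zo y)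

/-- THE NOTEBOOK MAP `T : y ↦ concluded bounds` (componentwise max over the two points; `Γ₃ = 1`). [cite: FitznerVanDerHofstad2017, notebook Percolation.nb cells 46–56 (transcript l.1286–1444)] [cite: FitznerVanDerHofstad2016NoBLE, Def. 2.9, PTRF p. 1060] -/
def T (y : State) : State where
  Gamma1 := max (Φ.part1 y Pt.i) (Φ.part1 y Pt.o)
  m := max (Φ.mlow y Pt.i) (Φ.mlow y Pt.o)
  Gamma2 := max (Φ.F2 y Pt.i) (Φ.F2 y Pt.o)
  c := fun j => max (Φ.initCell j) (Φ.cellT y j)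

/-- THE MONOTONE MINORANT `T'` (M3 patch + `afmax` evaluator `AF`). [folklore] -/
def T' (AF : State → ℝ) (y : State) : State where
  Gamma1 := max (Φ.part1 y Pt.i) (Φ.part1 y Pt.o)
  m := max (Φ.mlow y Pt.i) (Φ.mlow y Pt.o)
  Gamma2 := max (Φ.F2 y Pt.i) (Φ.F2 y Pt.o)
  c := fun j => max (Φ.initCell j) (Φ.cellT' AF y j)

/-- CLOSING at `y`: cells 45 ∧ 56 at both points, in the coordinates `(Γ₁, m, Γ₂, c)` with `Γ₃ = 1`, together with
the standing hypotheses of App. D and the PUBLISHED standing conditions of the bootstrap itself — [NoBLE17] Lemma 2.1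
(`1 ≤ γ_i < Γ_i`, whence `Γ₁, Γ₂ > 1`) and `c_μ > 0` (whence `m > 0`), which make the floor `(Γ₁, m, Γ₂) = (1, 0, 1)`
lie below EVERY closing tuple with no further hypothesis (`noGo_all_std`).  `SuccesF[3,s]` (`max_j cell_j/c_j < 1 ∧ > 0`) is rendered as
`cell_j < c_j` for every `j` at both points (equivalent for positive weights; [NoBLE17] Def. 2.9 needs `f₃(z_I) ≤ γ₃`,
i.e. positive weights); TechCondition II (`α̲_F + β̲_{ΔR,F} > 0`) is implied by `f2pos` and omitted.  The
first field is the stage-1 standing hypothesis `y ∈ U` (the series behind cells 3–43 converge). [cite: FitznerVanDerHofstad2017, notebook Percolation.nb cells 45, 55–56 (transcript l.1267–1270, 1429–1444)] [cite: FitznerVanDerHofstad2016NoBLE, Def. 2.9, PTRF p. 1060; App. D, PTRF pp. 1110–1117] -/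
structure Closes (y : State) : Prop where
  stage1 : Φ.U y
  m_lt_one : y.m < 1
  /-- [NoBLE17] Lemma 2.1 (Bootstrap argument) is stated for `1 ≤ γ₁ < Γ₁`: a closing tuple has `Γ₁ > 1`. -/
  one_lt_Gamma1 : 1 < y.Gamma1
  /-- [NoBLE17] Lemma 2.1: `1 ≤ γ₂ < Γ₂`, so `Γ₂ > 1`.  (`Γ₃` is normalised to `1` by the notebook, the weights `c_j`
  carrying the scale, so `1 ≤ γ₃ < Γ₃` imposes nothing here.) -/
  one_lt_Gamma2 : 1 < y.Gamma2
  /-- `m = Γ₁/((2d−1)c_μ) > 0`: cell 44 `mu[s] = VarGamma1/((2d−1) cmu)` with `Γ₁ > 1` and the constant `c_μ > 1` of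
  [NoBLE17] (2.20) ("where `c_μ > 1` …"); only `c_μ > 0` is used.  (`c_μ > 1` itself reads `(2d−1)·m < Γ₁` in these
  coordinates and is NOT imposed.) -/
  m_pos : 0 < y.m
  muMin_nonneg : ∀ s, 0 ≤ ((Φ.S y).inp s).muMin
  tmp2_lt_one : ∀ s, Φ.tmp2At y s < 1
  kapPsi_lt_one : ∀ s, Φ.kap * (Φ.betaAt y s).βΨ < 1
  techI : ∀ s, 0 < Φ.techI y s
  techIII : ∀ s, Φ.techIII y s < 1
  f1part1 : ∀ s, Φ.part1 y s < y.Gamma1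
  f1part2 : ∀ s, Φ.mlow y s < y.m
  f2pos : ∀ s, 0 < Φ.F2 y s
  f2 : ∀ s, Φ.F2 y s < y.Gamma2
  f3init : ∀ j, Φ.initCell j < y.c j
  f3 : ∀ j, Φ.cellT y j < y.c j

/-- ADMISSIBILITY on the box `m ≤ m₂`: the downward-closed part of `Closes` that the monotonicity proofs use
(an escape `¬ Adm` may thus be certified by ANY failing field: `U`, `m < 1`, the ratio, `den > 0`, `TechI > 0`, …). [folklore] -/
structure Adm (m₂ : ℝ) (y : State) : Prop where
  stage1 : Φ.U y
  m_lt_one : y.m < 1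
  m_le : y.m ≤ m₂
  muMin_nonneg : ∀ s, 0 ≤ ((Φ.S y).inp s).muMin
  tmp2_lt_one : ∀ s, Φ.tmp2At y s < 1
  kapPsi_lt_one : ∀ s, Φ.kap * (Φ.betaAt y s).βΨ < 1
  den2_pos : ∀ s, 0 < Φ.den2 y s
  techI_pos : ∀ s, 0 < Φ.techI y s

/-- THE STAGE-1 HYPOTHESES above the floor `y₀` (the untyped residue, HOME/GAPS.md N28): `d ≥ 2`, tables `≥ 0`;
the validity region `U` is downward closed in the cone above `y₀`; stage 1 is fieldwise monotone (mixed-sign order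
`BetaMap.Inputs.Dom`) between comparable points of the cone whose upper point lies in `U` and has the structural signs
on `U` (HOME/MARGINS.md M1–M6, §9 audit); the wiring identity `mu[s] = m` of cell 44; and four sign checks AT THE FLOOR
(certified numerics): `0 ≤ m(y₀)`, `0 ≤ Γ₁(y₀)`, `0 ≤ Γ₂(y₀)`, `0 ≤ 1 + β_Π̂(y₀, s)`. [folklore] -/
structure Hyp (y₀ : State) : Prop where
  two_le_d : 2 ≤ Φ.d
  tables : Φ.τ.Nonneg
  U_down : ∀ ⦃x y : State⦄, y₀ ≤ x → x ≤ y → Φ.U y → Φ.U x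
  mono : ∀ ⦃x y : State⦄, y₀ ≤ x → x ≤ y → Φ.U y → (Φ.S x).Dom (Φ.S y)
  nonneg : ∀ ⦃y : State⦄, y₀ ≤ y → Φ.U y → (Φ.S y).Nonneg
  mu_eq : ∀ ⦃y : State⦄, y₀ ≤ y → ∀ s, ((Φ.S y).inp s).mu = y.m
  m_floor : 0 ≤ y₀.m
  Gamma1_floor : 0 ≤ y₀.Gamma1
  Gamma2_floor : 0 ≤ y₀.Gamma2
  onePlusPi_floor : ∀ s, 0 ≤ 1 + (Φ.betaAt y₀ s).βPi

/-- An ADMISSIBLE EVALUATOR of the `afmax` slot on the box `m ≤ m₂`: monotone between comparable points of the cone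
whose upper point is admissible, a minorant of the true `ᾱ_F` there, and `≥ 0` at the floor. [folklore] -/
structure AFHyp (y₀ : State) (m₂ : ℝ) (AF : State → ℝ) : Prop where
  mono : ∀ ⦃x y : State⦄, y₀ ≤ x → x ≤ y → Φ.Adm m₂ y → AF x ≤ AF y
  le : ∀ ⦃y : State⦄, y₀ ≤ y → Φ.Adm m₂ y → AF y ≤ Φ.exAt y Pt.o 1
  floor_nonneg : 0 ≤ AF y₀

end Defs

/-! ## Proofs -/

section Proofs

variable {ν : Type*} {Φ : Frame ν} {y₀ : State} {m₂ : ℝ}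

/-! ### Elementary facts about the dimension -/

/-- `1 ≤ d`. [folklore] -/
theorem Hyp.one_le_d (H : Φ.Hyp y₀) : 1 ≤ Φ.d := by linarith [H.two_le_d]
/-- `0 < d`. [folklore] -/
theorem Hyp.d_pos (H : Φ.Hyp y₀) : 0 < Φ.d := by linarith [H.two_le_d]
/-- `0 < 2d − 1`. [folklore] -/
theorem Hyp.twod1_pos (H : Φ.Hyp y₀) : 0 < 2 * Φ.d - 1 := by linarith [H.two_le_d]
/-- `0 < 2d − 2`. [folklore] -/
theorem Hyp.twod2_pos (H : Φ.Hyp y₀) : 0 < 2 * Φ.d - 2 := by linarith [H.two_le_d]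
/-- `0 ≤ 2d/(2d−1)`. [folklore] -/
theorem Hyp.kap_nonneg (H : Φ.Hyp y₀) : 0 ≤ Φ.kap :=
  div_nonneg (by linarith [H.two_le_d]) H.twod1_pos.le
/-- `0 ≤ (2d−2)/(2d−1)`. [folklore] -/
theorem Hyp.ratio_nonneg (H : Φ.Hyp y₀) : 0 ≤ (2 * Φ.d - 2) / (2 * Φ.d - 1) :=
  div_nonneg H.twod2_pos.le H.twod1_pos.le
/-- `0 ≤ (2d−1)/(2d−2)`. [folklore] -/
theorem Hyp.ratio'_nonneg (H : Φ.Hyp y₀) : 0 ≤ (2 * Φ.d - 1) / (2 * Φ.d - 2) :=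
  div_nonneg H.twod1_pos.le H.twod2_pos.le

/-! ### The as-coded wirings (D20, D31): record-level monotonicity and signs

`BoundMapMonotone` treats the printed wirings `nobleBetaOfInputs` / `extraOfInputs`; the two as-coded variants of
`BetaMap` differ in ONE argument each and inherit monotonicity from the same function-level lemmas. -/

section AsCoded

variable {d : ℝ} {a b : Inputs}

/-- D20 as coded: `β_Δ = −betaRfDeltaLower[…]` with the ODD aggregate in both `XiIotaDeltaZero{Odd,Even}` slots is
non-decreasing along `Inputs.Dom` between well-formed records. [folklore] -/
theorem betaDeltaAsCoded_mono (hd : 1 ≤ d) (ha : a.WF d) (hb : b.WF d) (h : a.Dom b) :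
    (nobleBetaOfInputsAsCoded d a).βΔ ≤ (nobleBetaOfInputsAsCoded d b).βΔ := by
  have F := ha.facts hd
  simp only [nobleBetaOfInputsAsCoded]
  exact neg_le_neg (betaRfDeltaLower_anti_fn F.d_pos ha.mu_nonneg h.mu hb.mu_lt_one h.mubOverMu h.mub h.xiAbs
    h.xiOdd h.xiEven h.xiDeltaAbs h.xiOddDelta h.xiEvenDelta h.xiOddTail h.xiOddTailDelta h.xiEvenTailDelta
    h.psiRI1Delta h.psiRII0Delta h.xiIotaAbs h.xiIotaOdd h.xiIotaEven h.xiIotaDeltaEi h.xiIotaOddDeltaEi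
    h.xiIotaEvenDeltaEi h.xiIotaDeltaZero h.xiIotaOddDeltaZero h.xiIotaOddDeltaZero h.xiIotaEvenTail
    h.xiIotaEvenTailDeltaEi h.piR0DeltaEiEk ha.mubOverMu ha.mub ha.xiAbs ha.xiOdd ha.xiEven ha.xiDeltaAbs
    ha.xiOddDelta ha.xiEvenDelta ha.xiOddTail ha.xiOddTailDelta ha.xiEvenTailDelta ha.psiRI1Delta ha.psiRII0Delta
    ha.xiIotaAbs ha.xiIotaOdd ha.xiIotaEven ha.xiIotaDeltaEi ha.xiIotaOddDeltaEi ha.xiIotaEvenDeltaEi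
    ha.xiIotaDeltaZero ha.xiIotaOddDeltaZero ha.xiIotaOddDeltaZero ha.xiIotaEvenTail ha.xiIotaEvenTailDeltaEi
    ha.piR0DeltaEiEk hb.tmp2_lt_one)

/-- D20 as coded: `β_Δ ≥ 0` on the well-formed region. [folklore] -/
theorem betaDeltaAsCoded_nonneg (hd : 1 ≤ d) (ha : a.WF d) : 0 ≤ (nobleBetaOfInputsAsCoded d a).βΔ := by
  have F := ha.facts hd
  simp only [nobleBetaOfInputsAsCoded]
  exact neg_nonneg.2 (betaRfDeltaLower_nonpos_fn F.d_pos ha.mu_nonneg ha.mu_lt_one ha.mubOverMu ha.mub ha.xiAbs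
    ha.xiOdd ha.xiEven ha.xiDeltaAbs ha.xiOddDelta ha.xiEvenDelta ha.xiOddTail ha.xiOddTailDelta ha.xiEvenTailDelta
    ha.psiRI1Delta ha.psiRII0Delta ha.xiIotaAbs ha.xiIotaOdd ha.xiIotaEven ha.xiIotaDeltaEi ha.xiIotaOddDeltaEi
    ha.xiIotaEvenDeltaEi ha.xiIotaDeltaZero ha.xiIotaOddDeltaZero ha.xiIotaOddDeltaZero ha.xiIotaEvenTail
    ha.xiIotaEvenTailDeltaEi ha.piR0DeltaEiEk ha.tmp2_lt_one)

/-- D31 as coded: (D.21) with the UNWEIGHTED `xiR0 + xiR1` in slot `XiDeltaR` is non-decreasing along `Inputs.Dom`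
between well-formed records. [folklore] -/
theorem rpDeltaAsCoded_mono (hd : 1 ≤ d) (ha : a.WF d) (hb : b.WF d) (h : a.Dom b) :
    extraOfInputsAsCoded d a 3 ≤ extraOfInputsAsCoded d b 3 := by
  have F := ha.facts hd
  simp only [extraOfInputsAsCoded, Matrix.cons_val]
  exact betaRpDelta_mono_fn F.d_pos ha.mu_nonneg h.mu hb.mu_lt_one h.mubOverMu h.mub h.xiAbs h.xiDeltaAbs
    (add_le_add h.xiR0 h.xiR1) (add_le_add h.xiOddTailDelta h.xiEvenTailDelta) h.xiIotaAbs h.xiIotaDeltaEi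
    h.xiIotaDeltaZero (add_le_add h.xiIotaOddDeltaEi h.xiIotaEvenTailDeltaEi)
    (add_le_add h.xiIotaOddDeltaZero h.xiIotaEvenTailDeltaZero) h.xiIotaRI0DeltaEi h.xiIotaRII0DeltaZero
    ha.mubOverMu ha.mub ha.xiAbs ha.xiDeltaAbs (add_nonneg ha.xiR0 ha.xiR1)
    (add_nonneg ha.xiOddTailDelta ha.xiEvenTailDelta) ha.xiIotaAbs ha.xiIotaDeltaEi ha.xiIotaDeltaZero
    (add_nonneg ha.xiIotaOddDeltaEi ha.xiIotaEvenTailDeltaEi) (add_nonneg ha.xiIotaOddDeltaZero ha.xiIotaEvenTailDeltaZero)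
    ha.xiIotaRI0DeltaEi ha.xiIotaRII0DeltaZero hb.tmp2_lt_one

/-- D31 as coded: component 3 `≥ 0` on the well-formed region. [folklore] -/
theorem rpDeltaAsCoded_nonneg (hd : 1 ≤ d) (ha : a.WF d) : 0 ≤ extraOfInputsAsCoded d a 3 := by
  have F := ha.facts hd
  simp only [extraOfInputsAsCoded, Matrix.cons_val]
  exact betaRpDelta_nonneg_fn F.d_pos ha.mu_nonneg ha.mu_lt_one ha.mubOverMu ha.mub ha.xiAbs ha.xiDeltaAbs
    (add_nonneg ha.xiR0 ha.xiR1) (add_nonneg ha.xiOddTailDelta ha.xiEvenTailDelta) ha.xiIotaAbs ha.xiIotaDeltaEi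
    ha.xiIotaDeltaZero (add_nonneg ha.xiIotaOddDeltaEi ha.xiIotaEvenTailDeltaEi)
    (add_nonneg ha.xiIotaOddDeltaZero ha.xiIotaEvenTailDeltaZero) ha.xiIotaRI0DeltaEi ha.xiIotaRII0DeltaZero
    ha.tmp2_lt_one

end AsCoded

/-! ### The wiring-selected slots are monotone / signed in every wiring -/

/-- `0 ≤ β_Δ` in either wiring, on the well-formed region. [folklore] -/
theorem deltaAt_nonneg (hd : 1 ≤ Φ.d) {y : State} {s : Pt} (W : ((Φ.S y).inp s).WF Φ.d) : 0 ≤ Φ.deltaAt y s := by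
  unfold deltaAt; split
  · exact betaDeltaAsCoded_nonneg hd W
  · exact betaDelta_nonneg hd W

/-- `β_Δ` is monotone in the inputs in either wiring. [folklore] -/
theorem deltaAt_mono (hd : 1 ≤ Φ.d) {x y : State} {s : Pt} (Wx : ((Φ.S x).inp s).WF Φ.d)
    (Wy : ((Φ.S y).inp s).WF Φ.d) (D : ((Φ.S x).inp s).Dom ((Φ.S y).inp s)) : Φ.deltaAt x s ≤ Φ.deltaAt y s := by
  unfold deltaAt; split
  · exact betaDeltaAsCoded_mono hd Wx Wy D
  · exact betaDelta_mono hd Wx Wy D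

/-- `0 ≤ β_{ΔR,Φ}` in either wiring. [folklore] -/
theorem rpDeltaAt_nonneg (hd : 1 ≤ Φ.d) {y : State} {s : Pt} (W : ((Φ.S y).inp s).WF Φ.d) :
    0 ≤ Φ.rpDeltaAt y s := by
  unfold rpDeltaAt; split
  · exact rpDeltaAsCoded_nonneg hd W
  · exact betaRpDelta_nonneg hd W

/-- `β_{ΔR,Φ}` is monotone in the inputs in either wiring. [folklore] -/
theorem rpDeltaAt_mono (hd : 1 ≤ Φ.d) {x y : State} {s : Pt} (Wx : ((Φ.S x).inp s).WF Φ.d)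
    (Wy : ((Φ.S y).inp s).WF Φ.d) (D : ((Φ.S x).inp s).Dom ((Φ.S y).inp s)) :
    Φ.rpDeltaAt x s ≤ Φ.rpDeltaAt y s := by
  unfold rpDeltaAt; split
  · exact rpDeltaAsCoded_mono hd Wx Wy D
  · exact betaRpDelta_mono hd Wx Wy D

/-- The `bRp` slot value is `≥ 0` in either wiring. [folklore] -/
theorem bRpSlot_nonneg (hd : 1 ≤ Φ.d) {y : State} (W : ((Φ.S y).inp Pt.o).WF Φ.d) : 0 ≤ Φ.bRpSlot y := by
  unfold bRpSlot; split
  · exact betaRF_nonneg hd W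
  · exact betaRPhi_nonneg hd W

/-- The `bRp` slot value is monotone in the inputs in either wiring. [folklore] -/
theorem bRpSlot_mono (hd : 1 ≤ Φ.d) {x y : State} (Wx : ((Φ.S x).inp Pt.o).WF Φ.d)
    (Wy : ((Φ.S y).inp Pt.o).WF Φ.d) (D : ((Φ.S x).inp Pt.o).Dom ((Φ.S y).inp Pt.o)) :
    Φ.bRpSlot x ≤ Φ.bRpSlot y := by
  unfold bRpSlot; split
  · exact betaRF_mono hd Wx Wy D
  · exact betaRPhi_mono hd Wx Wy D

/-- The `bRf` slot value is monotone in the inputs in either wiring. [folklore] -/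
theorem bRfSlot_mono (hd : 1 ≤ Φ.d) {x y : State} (Wx : ((Φ.S x).inp Pt.o).WF Φ.d)
    (Wy : ((Φ.S y).inp Pt.o).WF Φ.d) (D : ((Φ.S x).inp Pt.o).Dom ((Φ.S y).inp Pt.o)) :
    Φ.bRfSlot x ≤ Φ.bRfSlot y := by
  unfold bRfSlot; split
  · exact betaRPhi_mono hd Wx Wy D
  · exact betaRF_mono hd Wx Wy D

/-! ### Real-variable monotonicity of the expressions of cells 45–47 -/

/-- The series ratio `2d·M/(1−u)·X` is monotone in `(M, u, X)` (`M, X ≥ 0`, `u' < 1`). [folklore] -/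
theorem ratio_mono {d M M' u u' X X' : ℝ} (hd : 0 ≤ d) (hM : M ≤ M') (hM0 : 0 ≤ M) (hu : u ≤ u')
    (hu1 : u' < 1) (hX : X ≤ X') (hX0 : 0 ≤ X) :
    2 * d * M / (1 - u) * X ≤ 2 * d * M' / (1 - u') * X' := by
  have e1' : 0 < 1 - u' := by linarith
  have e1 : 0 < 1 - u := by linarith
  have hM0' : 0 ≤ M' := hM0.trans hM
  have h1 : 2 * d * M / (1 - u) ≤ 2 * d * M' / (1 - u') := by
    calc 2 * d * M / (1 - u) ≤ 2 * d * M' / (1 - u) := by gcongr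
      _ ≤ 2 * d * M' / (1 - u') := by
        apply div_le_div_of_nonneg_left (by positivity) e1' (by linarith)
  have h0 : 0 ≤ 2 * d * M' / (1 - u') := by positivity
  exact mul_le_mul h1 hX hX0 h0

/-- Cell 46 part 1 is monotone: `M(1+P)/(1−κQ)` in `(M, P, Q)` for `M' ≥ 0`, `1+P ≥ 0`, `κ ≥ 0`, `κQ' < 1`.
[folklore] -/
theorem part1_mono_real {M M' P P' Q Q' κ : ℝ} (hM : M ≤ M') (hM' : 0 ≤ M') (hP : P ≤ P')
    (hP0 : 0 ≤ 1 + P) (hQ : Q ≤ Q') (hκ : 0 ≤ κ) (hQ' : κ * Q' < 1) :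
    M * (1 + P) / (1 - κ * Q) ≤ M' * (1 + P') / (1 - κ * Q') := by
  have hD' : 0 < 1 - κ * Q' := by linarith
  have hκQ : κ * Q ≤ κ * Q' := mul_le_mul_of_nonneg_left hQ hκ
  have hD : 1 - κ * Q' ≤ 1 - κ * Q := by linarith
  have hDpos : 0 < 1 - κ * Q := lt_of_lt_of_le hD' hD
  have hP0' : 0 ≤ 1 + P' := by linarith
  have hN : M * (1 + P) ≤ M' * (1 + P') := by
    nlinarith [mul_le_mul_of_nonneg_right hM hP0, mul_le_mul_of_nonneg_left (by linarith : 1 + P ≤ 1 + P') hM']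
  have hN' : 0 ≤ M' * (1 + P') := mul_nonneg hM' hP0'
  calc M * (1 + P) / (1 - κ * Q) ≤ M' * (1 + P') / (1 - κ * Q) := div_le_div_of_nonneg_right hN hDpos.le
    _ ≤ M' * (1 + P') / (1 - κ * Q') := div_le_div_of_nonneg_left hN' hD' hD

/-- Cell 46 part 2 (as the lower bound on `m`) is monotone: `(1+P)/((2d−1)(1−κQ))` in `(P, Q)`. [folklore] -/
theorem mlow_mono_real {P P' Q Q' κ d : ℝ} (hd : 0 < 2 * d - 1) (hP : P ≤ P') (hP0 : 0 ≤ 1 + P) (hQ : Q ≤ Q')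
    (hκ : 0 ≤ κ) (hQ' : κ * Q' < 1) :
    (1 + P) / ((2 * d - 1) * (1 - κ * Q)) ≤ (1 + P') / ((2 * d - 1) * (1 - κ * Q')) := by
  have hD' : 0 < 1 - κ * Q' := by linarith
  have hκQ : κ * Q ≤ κ * Q' := mul_le_mul_of_nonneg_left hQ hκ
  have hD : 1 - κ * Q' ≤ 1 - κ * Q := by linarith
  have hP0' : 0 ≤ 1 + P' := by linarith
  have hE' : 0 < (2 * d - 1) * (1 - κ * Q') := mul_pos hd hD'
  have hE : (2 * d - 1) * (1 - κ * Q') ≤ (2 * d - 1) * (1 - κ * Q) := mul_le_mul_of_nonneg_left hD hd.le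
  have hEpos : 0 < (2 * d - 1) * (1 - κ * Q) := lt_of_lt_of_le hE' hE
  calc (1 + P) / ((2 * d - 1) * (1 - κ * Q)) ≤ (1 + P') / ((2 * d - 1) * (1 - κ * Q)) :=
        div_le_div_of_nonneg_right (by linarith) hEpos.le
    _ ≤ (1 + P') / ((2 * d - 1) * (1 - κ * Q')) := div_le_div_of_nonneg_left hP0' hE' hE

/-- Cell 47 is monotone: `κ'·(N/D)` in `(N, D)` for `κ' ≥ 0`, `N' ≥ 0`, `0 < D' ≤ D`. [folklore] -/
theorem F2_mono_real {κ' N N' D D' : ℝ} (hκ : 0 ≤ κ') (hN : N ≤ N') (hN' : 0 ≤ N') (hD' : 0 < D')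
    (hDD : D' ≤ D) : κ' * (N / D) ≤ κ' * (N' / D') := by
  apply mul_le_mul_of_nonneg_left _ hκ
  have hD : 0 < D := lt_of_lt_of_le hD' hDD
  rw [div_le_div_iff₀ hD hD']
  nlinarith [mul_le_mul_of_nonneg_right hN hD'.le, mul_le_mul_of_nonneg_left hDD hN']

/-- Cell 46 in the coordinate `m`: with `c_μ = Γ₁/((2d−1)m)`, `boundF1[part2,s] < Γ₁ ↔ mlow s < m`
(`Γ₁, m > 0`, positive denominator).  This is the only place where the change of coordinates matters. [folklore] -/
theorem f1part2_iff {Γ₁ m P Q κ d : ℝ} (hΓ : 0 < Γ₁) (hm : 0 < m) (hD : 0 < 1 - κ * Q)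
    (hd : 0 < 2 * d - 1) :
    Γ₁ / ((2 * d - 1) * m) * (1 + P) / (1 - κ * Q) < Γ₁ ↔ (1 + P) / ((2 * d - 1) * (1 - κ * Q)) < m := by
  have h1 : (2 * d - 1) ≠ 0 := hd.ne'
  have h2 : m ≠ 0 := hm.ne'
  have h3 : 1 - κ * Q ≠ 0 := hD.ne'
  have key : Γ₁ / ((2 * d - 1) * m) * (1 + P) / (1 - κ * Q)
      = Γ₁ * ((1 + P) / ((2 * d - 1) * (1 - κ * Q)) / m) := by
    field_simp
  rw [key, mul_lt_iff_lt_one_right hΓ, div_lt_one hm]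

/-! ### Signs of the `F3Bounds` cells on well-formed arguments -/

/-- (3.71) is `≥ 0` for `n ≤ 2` on well-formed arguments (tables `≥ 0`). [folklore] -/
theorem boundH1_nonneg {τ : Tables ν} (hτ : τ.Nonneg) {a : Args} (ha : a.WF) (l : ℕ) (v : ν) :
    ∀ n ≤ 2, 0 ≤ boundH1 τ n l v a := by
  obtain ⟨hG, hcp, haf, hafx, hap, hRp, hRfD, hRpD, hK⟩ := ha
  have hIM := hτ.IM; have hT := hτ.T
  intro n hn
  match n, hn with
  | 0, _ =>
    have := hIM 0 l v; have := hIM 0 (l+1) v; have := hIM (-1) l v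
    simp only [boundH1]; positivity
  | 1, _ =>
    have := hIM 1 l v; have := hIM 0 l v; have := hIM 1 (l+1) v; have := hIM 0 (l+1) v
    have := hIM 1 (l+2) v; have := hT 3 l v; have := hT 3 (l+1) v; have := hT 2 l v
    simp only [boundH1]; positivity
  | 2, _ =>
    have := hIM 2 l v; have := hIM 1 l v; have := hIM 2 (l+1) v; have := hIM 1 (l+1) v
    have := hIM 2 (l+2) v; have := hIM 1 (l+2) v; have := hIM 2 (l+3) v
    have := hT 4 l v; have := hT 4 (l+1) v; have := hT 3 l v; have := hT 4 (l+2) v; have := hT 3 (l+1) v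
    simp only [boundH1]; positivity
  | k + 3, hk => omega

/-- The M3-patched numerator of (3.87) is `≥ 0` for `n ≤ 2` on well-formed arguments. [folklore] -/
theorem boundHMono_nonneg {τ : Tables ν} (hτ : τ.Nonneg) {a : Args} (ha : a.WF) {n : ℕ} (hn : n ≤ 2)
    (l : ℕ) (v : ν) : 0 ≤ boundHMono τ n l v a := by
  have h1 := boundH1_nonneg hτ ha l v n hn
  obtain ⟨hG, hcp, haf, hafx, hap, hRp, hRfD, hRpD, hK⟩ := ha
  have h3 := m3Mono_nonneg a
  have := hτ.T (n+2) l v; have := hτ.T (n+2) (l+1) v; have := hτ.T (n+1) l v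
  have := hτ.U (n+2) l v; have := hτ.U (n+3) l v; have := hτ.K n l v; have := hτ.K (n+1) l v
  unfold boundHMono boundH2 boundH3Mono boundH4 boundH5
  positivity

/-- `boundFThreeMono ≥ 0` for `n ≤ 2` on well-formed arguments. [folklore] -/
theorem boundFThreeMono_nonneg {τ : Tables ν} (hτ : τ.Nonneg) {a : Args} (ha : a.WF) {n : ℕ} (hn : n ≤ 2)
    (l : ℕ) (v₀ : ν) (vs : List ν) : 0 ≤ boundFThreeMono τ n l v₀ vs a := by
  unfold boundFThreeMono
  induction vs with
  | nil => simpa using boundHMono_nonneg hτ ha hn l v₀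
  | cons v vs ih =>
    simp only [List.foldr_cons]
    exact le_max_of_le_right ih

/-! ### Monotonicity of cells 50–54 in the inner evaluator and the G-bounds -/

/-- The six cells are monotone in `(B, G, z)` (`B(1,2,{{1}}), G₂₂, G₀₁₂, z ≥ 0`). [folklore] -/
theorem cells_mono (H : Φ.Hyp y₀) {B B' : ℕ → ℕ → ν → List ν → ℝ}
    {G11 G22 G012 z G11' G22' G012' z' : ℝ}
    (hB : ∀ n l v vs, B n l v vs ≤ B' n l v vs) (hB0 : 0 ≤ B 1 2 Φ.n1 [])
    (h11 : G11 ≤ G11') (h22 : G22 ≤ G22') (h012 : G012 ≤ G012') (g22 : 0 ≤ G22) (g012 : 0 ≤ G012)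
    (hz : z ≤ z') (gz : 0 ≤ z) :
    Φ.cells B G11 G22 G012 z ≤ Φ.cells B' G11' G22' G012' z' := by
  have hd := H.d_pos
  have hd2 := H.twod2_pos.le
  have gz' := gz.trans hz
  have hB0' : 0 ≤ B' 1 2 Φ.n1 [] := hB0.trans (hB _ _ _ _)
  have hIf : ∀ n l, Φ.bIf B n l ≤ Φ.bIf B' n l := by
    intro n l; unfold bIf; split <;> exact hB _ _ _ _
  have hT0 : 0 ≤ Φ.tmpN B G22 G012 z := by unfold tmpN; positivity
  have hT : Φ.tmpN B G22 G012 z ≤ Φ.tmpN B' G22' G012' z' := by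
    unfold tmpN
    have h12 := hB 1 2 Φ.n1 []
    have p1 : 2 * Φ.d * z * B 1 2 Φ.n1 [] ≤ 2 * Φ.d * z' * B' 1 2 Φ.n1 [] :=
      mul_le_mul (by gcongr) h12 hB0 (by positivity)
    have p2 : 1 / (2 * Φ.d) * ((2 * Φ.d - 2) * 2 * G22 + 4 * G012)
        ≤ 1 / (2 * Φ.d) * ((2 * Φ.d - 2) * 2 * G22' + 4 * G012') := by
      apply mul_le_mul_of_nonneg_left _ (by positivity)
      nlinarith [mul_le_mul_of_nonneg_left h22 hd2]
    linarith
  have hT' : 2 * Φ.d * z * Φ.tmpN B G22 G012 z ≤ 2 * Φ.d * z' * Φ.tmpN B' G22' G012' z' :=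
    mul_le_mul (by gcongr) hT hT0 (by positivity)
  intro j
  fin_cases j
  · simp only [cells]
    exact min_le_min (hB _ _ _ _) (hB _ _ _ _)
  · simp only [cells]
    exact max_le_max h11 (max_le_max (by linarith) (max_le_max (by linarith) (hIf 0 0)))
  · simp only [cells]
    refine max_le_max (add_le_add hT' h11) (max_le_max (add_le_add (hB _ _ _ _) (by linarith))
      (max_le_max (add_le_add (hB _ _ _ _) (by linarith)) (hIf 1 0)))
  · simp only [cells]
    exact max_le_max hT (hB _ _ _ _)
  · simp only [cells]
    exact hB _ _ _ _
  · simp only [cells]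
    exact hB _ _ _ _

/-! ### Well-formedness and admissibility in the cone above the floor -/

/-- At an admissible point of the cone the App. D inputs are well formed (both points). [folklore] -/
theorem wf_of_adm (H : Φ.Hyp y₀) {y : State} (hy : y₀ ≤ y) (hA : Φ.Adm m₂ y) (s : Pt) :
    ((Φ.S y).inp s).WF Φ.d where
  toNonneg := (H.nonneg hy hA.stage1).inp s
  mu_nonneg := by rw [H.mu_eq hy s]; exact H.m_floor.trans hy.2.1
  mu_lt_one := by rw [H.mu_eq hy s]; exact hA.m_lt_one
  muMin_nonneg := hA.muMin_nonneg s
  tmp2_lt_one := hA.tmp2_lt_one s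

/-- REFEREE R6 (iii): admissibility is DOWNWARD CLOSED between comparable points of the cone. [folklore] -/
theorem adm_down (H : Φ.Hyp y₀) {x y : State} (hx : y₀ ≤ x) (hxy : x ≤ y) (hA : Φ.Adm m₂ y) :
    Φ.Adm m₂ x := by
  have hy : y₀ ≤ y := le_trans hx hxy
  have hd1 := H.one_le_d
  have hUx : Φ.U x := H.U_down hx hxy hA.stage1
  have D := H.mono hx hxy hA.stage1
  have Nx := H.nonneg hx hUx
  have hWFy : ∀ s, ((Φ.S y).inp s).WF Φ.d := wf_of_adm H hy hA
  have hm1 : x.m < 1 := lt_of_le_of_lt hxy.2.1 hA.m_lt_one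
  have hm2 : x.m ≤ m₂ := hxy.2.1.trans hA.m_le
  have hmuMin : ∀ s, 0 ≤ ((Φ.S x).inp s).muMin :=
    fun s => (hA.muMin_nonneg s).trans (D.inp s).muMin
  have htmp : ∀ s, Φ.tmp2At x s < 1 := by
    intro s
    refine lt_of_le_of_lt ?_ (hA.tmp2_lt_one s)
    unfold tmp2At
    exact ratio_mono H.d_pos.le (D.inp s).mub (Nx.inp s).mub (D.inp s).mu (hWFy s).mu_lt_one
      (D.inp s).xiIotaAbs (Nx.inp s).xiIotaAbs
  have hWFx : ∀ s, ((Φ.S x).inp s).WF Φ.d := fun s =>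
    { toNonneg := Nx.inp s
      mu_nonneg := by rw [H.mu_eq hx s]; exact H.m_floor.trans hx.2.1
      mu_lt_one := by rw [H.mu_eq hx s]; exact hm1
      muMin_nonneg := hmuMin s
      tmp2_lt_one := htmp s }
  refine ⟨hUx, hm1, hm2, hmuMin, htmp, ?_, ?_, ?_⟩
  · intro s
    have h1 := betaPsi_mono hd1 (hWFx s) (hWFy s) (D.inp s)
    calc Φ.kap * (Φ.betaAt x s).βΨ ≤ Φ.kap * (Φ.betaAt y s).βΨ := mul_le_mul_of_nonneg_left h1 H.kap_nonneg
      _ < 1 := hA.kapPsi_lt_one s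
  · intro s
    have hΔy := deltaAt_nonneg hd1 (hWFy s)
    have hden := hA.den2_pos s
    have hpos : 0 < (Φ.betaAt y s).αFlow := by unfold den2 at hden; linarith
    have h1 := afLow_anti hd1 (hWFx s) (hWFy s) (D.inp s) hpos
    have h2 := deltaAt_mono hd1 (hWFx s) (hWFy s) (D.inp s)
    unfold den2 at hden ⊢
    linarith
  · intro s
    have h1 := cPhiLow_anti hd1 (hWFx s) (hWFy s) (D.inp s)
    have h2 := betaAlphaPhi_mono hd1 (hWFx s) (hWFy s) (D.inp s)
    have h3 := betaRPhi_mono hd1 (hWFx s) (hWFy s) (D.inp s)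
    have h0 := hA.techI_pos s
    unfold techI at h0 ⊢
    linarith

/-- REFEREE R6 (iii), second half: a closing point of the cone (in the box) is admissible — the denominator sign
`α̲_F − β_Δ > 0` follows from `0 < boundF2` because the numerator is `≥ c̄_Φ ≥ 1`. [folklore] -/
theorem adm_of_closes (H : Φ.Hyp y₀) {y : State} (hy : y₀ ≤ y) (hC : Φ.Closes y) (hm : y.m ≤ m₂) :
    Φ.Adm m₂ y := by
  have hd1 := H.one_le_d
  have W : ∀ s, ((Φ.S y).inp s).WF Φ.d := fun s =>
    { toNonneg := (H.nonneg hy hC.stage1).inp s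
      mu_nonneg := by rw [H.mu_eq hy s]; exact H.m_floor.trans hy.2.1
      mu_lt_one := by rw [H.mu_eq hy s]; exact hC.m_lt_one
      muMin_nonneg := hC.muMin_nonneg s
      tmp2_lt_one := hC.tmp2_lt_one s }
  refine ⟨hC.stage1, hC.m_lt_one, hm, hC.muMin_nonneg, hC.tmp2_lt_one, hC.kapPsi_lt_one, ?_, hC.techI⟩
  intro s
  have hN : 0 < Φ.num2 y s := by
    have h1 := one_le_cPhiUp hd1 (W s)
    have h2 := betaAlphaPhi_nonneg hd1 (W s)
    have h3 := betaRPhi_nonneg hd1 (W s)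
    unfold num2; linarith
  have hκ : 0 < (2 * Φ.d - 1) / (2 * Φ.d - 2) := div_pos H.twod1_pos H.twod2_pos
  have hF := hC.f2pos s
  unfold F2 at hF
  have hq : 0 < Φ.num2 y s / Φ.den2 y s := by
    rcases le_or_gt (Φ.num2 y s / Φ.den2 y s) 0 with h | h
    · have := mul_nonpos_of_nonneg_of_nonpos hκ.le h
      linarith
    · exact h
  rcases div_pos_iff.mp hq with ⟨_, hD⟩ | ⟨hN', _⟩
  · exact hD
  · linarith

/-- A closing point is a super-fixed point of the notebook map: `T y ≤ y`. [folklore] -/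
theorem T_le_of_closes {y : State} (hC : Φ.Closes y) : Φ.T y ≤ y :=
  ⟨max_le (hC.f1part1 _).le (hC.f1part1 _).le, max_le (hC.f1part2 _).le (hC.f1part2 _).le,
    max_le (hC.f2 _).le (hC.f2 _).le, fun j => max_le (hC.f3init j).le (hC.f3 j).le⟩

/-! ### The `F3Bounds.Args` record along the cone -/

/-- The cell-49 argument record is well formed at an admissible point of the cone (given `afmax ≥ 0`). [folklore] -/
theorem argsWith_WF (H : Φ.Hyp y₀) {y : State} (hy : y₀ ≤ y) (hA : Φ.Adm m₂ y) {af : ℝ} (haf : 0 ≤ af) :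
    (Φ.argsWith y af).WF := by
  have hd1 := H.one_le_d
  have W := wf_of_adm H hy hA Pt.o
  have hden := hA.den2_pos Pt.o
  have hΔ := deltaAt_nonneg hd1 W
  refine ⟨?_, ?_, ?_, haf, ?_, ?_, ?_, ?_, ?_⟩
  · exact mul_nonneg H.ratio_nonneg (H.Gamma2_floor.trans hy.2.2.1)
  · exact zero_le_one.trans (one_le_cPhiUp hd1 W)
  · show 0 < (Φ.betaAt y Pt.o).αFlow
    unfold den2 at hden; linarith
  · exact betaAlphaPhi_nonneg hd1 W
  · exact bRpSlot_nonneg hd1 W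
  · exact betaRfDelta_nonneg hd1 W
  · exact rpDeltaAt_nonneg hd1 W
  · exact (one_div_pos.2 hden).le

/-- The cell-49 argument record is monotone (in `F3Bounds.Args.Dom`) between comparable points of the cone whose
upper point is admissible, for `afmax` values `af ≤ af'`. [folklore] -/
theorem argsWith_dom (H : Φ.Hyp y₀) {x y : State} (hx : y₀ ≤ x) (hxy : x ≤ y) (hA : Φ.Adm m₂ y)
    {af af' : ℝ} (haf : af ≤ af') : (Φ.argsWith x af).Dom (Φ.argsWith y af') := by
  have hy : y₀ ≤ y := le_trans hx hxy
  have hd1 := H.one_le_d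
  have hAx := adm_down H hx hxy hA
  have Wx := wf_of_adm H hx hAx Pt.o
  have Wy := wf_of_adm H hy hA Pt.o
  have D := (H.mono hx hxy hA.stage1).inp Pt.o
  have hdeny := hA.den2_pos Pt.o
  have hΔy := deltaAt_nonneg hd1 Wy
  have hposy : 0 < (Φ.betaAt y Pt.o).αFlow := by unfold den2 at hdeny; linarith
  have h1 := afLow_anti hd1 Wx Wy D hposy
  have h2 := deltaAt_mono hd1 Wx Wy D
  refine ⟨?_, cPhiUp_mono hd1 Wx Wy D, h1, haf, betaAlphaPhi_mono hd1 Wx Wy D, bRfSlot_mono hd1 Wx Wy D,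
    bRpSlot_mono hd1 Wx Wy D, betaRfDelta_mono hd1 Wx Wy D, rpDeltaAt_mono hd1 Wx Wy D, ?_⟩
  · exact mul_le_mul_of_nonneg_left hxy.2.2.1 H.ratio_nonneg
  · have hle : Φ.den2 y Pt.o ≤ Φ.den2 x Pt.o := by unfold den2; linarith
    exact one_div_le_one_div_of_le hdeny hle

/-! ### REFEREE R6 (i) and (ii) -/

/-- REFEREE R6 (i): the minorant `T'` is MONOTONE between comparable points of the cone above the floor whose upper
point is admissible. [folklore] -/
theorem T'_mono (H : Φ.Hyp y₀) {AF : State → ℝ} (hAF : Φ.AFHyp y₀ m₂ AF) {x y : State} (hx : y₀ ≤ x)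
    (hxy : x ≤ y) (hA : Φ.Adm m₂ y) : Φ.T' AF x ≤ Φ.T' AF y := by
  have hy : y₀ ≤ y := le_trans hx hxy
  have hd1 := H.one_le_d
  have hτ := H.tables
  have hAx := adm_down H hx hxy hA
  have hA0 : Φ.Adm m₂ y₀ := adm_down H le_rfl hy hA
  have W0 := wf_of_adm H le_rfl hA0
  have Wx := wf_of_adm H hx hAx
  have Wy := wf_of_adm H hy hA
  have D := H.mono hx hxy hA.stage1
  have D0 := H.mono le_rfl hx hAx.stage1
  have Nx := H.nonneg hx hAx.stage1
  have Ny := H.nonneg hy hA.stage1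
  have hPi : ∀ s, 0 ≤ 1 + (Φ.betaAt x s).βPi := by
    intro s
    have := betaPi_mono hd1 (W0 s) (Wx s) (D0.inp s)
    have h0 := H.onePlusPi_floor s
    linarith
  have hpart1 : ∀ s, Φ.part1 x s ≤ Φ.part1 y s := by
    intro s
    unfold part1
    exact part1_mono_real (D.inp s).mubOverMu (Ny.inp s).mubOverMu
      (betaPi_mono hd1 (Wx s) (Wy s) (D.inp s)) (hPi s) (betaPsi_mono hd1 (Wx s) (Wy s) (D.inp s))
      H.kap_nonneg (hA.kapPsi_lt_one s)
  have hmlow : ∀ s, Φ.mlow x s ≤ Φ.mlow y s := by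
    intro s
    unfold mlow
    exact mlow_mono_real H.twod1_pos (betaPi_mono hd1 (Wx s) (Wy s) (D.inp s)) (hPi s)
      (betaPsi_mono hd1 (Wx s) (Wy s) (D.inp s)) H.kap_nonneg (hA.kapPsi_lt_one s)
  have hF2 : ∀ s, Φ.F2 x s ≤ Φ.F2 y s := by
    intro s
    have hdeny := hA.den2_pos s
    have hΔy := deltaAt_nonneg hd1 (Wy s)
    have hposy : 0 < (Φ.betaAt y s).αFlow := by unfold den2 at hdeny; linarith
    have h1 := afLow_anti hd1 (Wx s) (Wy s) (D.inp s) hposy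
    have h2 := deltaAt_mono hd1 (Wx s) (Wy s) (D.inp s)
    have h3 := cPhiUp_mono hd1 (Wx s) (Wy s) (D.inp s)
    have h4 := betaAlphaPhi_mono hd1 (Wx s) (Wy s) (D.inp s)
    have h5 := betaRPhi_mono hd1 (Wx s) (Wy s) (D.inp s)
    have g3 := one_le_cPhiUp hd1 (Wy s)
    have g4 := betaAlphaPhi_nonneg hd1 (Wy s)
    have g5 := betaRPhi_nonneg hd1 (Wy s)
    unfold F2
    refine F2_mono_real H.ratio'_nonneg ?_ ?_ hdeny ?_
    · unfold num2; linarith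
    · unfold num2; linarith
    · unfold den2; linarith
  have hAFx : 0 ≤ AF x := hAF.floor_nonneg.trans (hAF.mono le_rfl hx hAx)
  have hAFy : 0 ≤ AF y := hAFx.trans (hAF.mono hx hxy hA)
  have WAx := argsWith_WF H hx hAx hAFx
  have WAy := argsWith_WF H hy hA hAFy
  have DA := argsWith_dom H hx hxy hA (hAF.mono hx hxy hA)
  have hzo : Φ.zo x ≤ Φ.zo y := div_le_div_of_nonneg_right hxy.1 H.twod1_pos.le
  have hzo0 : 0 ≤ Φ.zo x := div_nonneg (H.Gamma1_floor.trans hx.1) H.twod1_pos.le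
  have hcell : Φ.cellT' AF x ≤ Φ.cellT' AF y := by
    unfold cellT'
    exact cells_mono H (fun n l v vs => boundFThreeMono_mono hτ WAx WAy DA n l v vs)
      (boundFThreeMono_nonneg hτ WAx (by norm_num) 2 Φ.n1 []) D.G11 D.G22 D.G012 Nx.G22 Nx.G012 hzo hzo0
  exact ⟨max_le_max (hpart1 _) (hpart1 _), max_le_max (hmlow _) (hmlow _), max_le_max (hF2 _) (hF2 _),
    fun j => max_le_max le_rfl (hcell j)⟩

/-- REFEREE R6 (ii): the minorant is below the notebook map on admissible points of the cone: `T' y ≤ T y`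
(M3 patch `≤` the `Max[|·|]` term, `AF ≤ ᾱ_F`). [folklore] -/
theorem T'_le_T (H : Φ.Hyp y₀) {AF : State → ℝ} (hAF : Φ.AFHyp y₀ m₂ AF) {y : State} (hy : y₀ ≤ y)
    (hA : Φ.Adm m₂ y) : Φ.T' AF y ≤ Φ.T y := by
  have hτ := H.tables
  have hAF0 : 0 ≤ AF y := hAF.floor_nonneg.trans (hAF.mono le_rfl hy hA)
  have hAFle := hAF.le hy hA
  have Wv := argsWith_WF H hy hA hAF0
  have Wt := argsWith_WF H hy hA (hAF0.trans hAFle)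
  have Dv : (Φ.argsWith y (AF y)).Dom (Φ.argsWith y (Φ.exAt y Pt.o 1)) := argsWith_dom H hy le_rfl hA hAFle
  have Ny := H.nonneg hy hA.stage1
  have hzo0 : 0 ≤ Φ.zo y := div_nonneg (H.Gamma1_floor.trans hy.1) H.twod1_pos.le
  have hcell : Φ.cellT' AF y ≤ Φ.cellT y := by
    unfold cellT' cellT
    exact cells_mono H
      (fun n l v vs => (boundFThreeMono_mono hτ Wv Wt Dv n l v vs).trans (boundFThreeMono_le hτ Wt n l v vs))
      (boundFThreeMono_nonneg hτ Wv (by norm_num) 2 Φ.n1 []) le_rfl le_rfl le_rfl Ny.G22 Ny.G012 le_rfl hzo0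
  exact ⟨le_rfl, le_rfl, le_rfl, fun j => max_le_max le_rfl (hcell j)⟩

/-! ### The no-go theorem and the two admissible `ᾱ_F` evaluators -/

/-- **NO-GO ON A BOX.**  For a frame satisfying the stage-1 hypotheses above the floor `y₀` and an admissible
`ᾱ_F`-evaluator on the box `m ≤ m₂`: if a chain `ys 0 = y₀`, `ys (j+1) ≤ T'(ys j)` (`j < k`) stays above the floor
and `ys k` is inadmissible, then NO state `y ≥ y₀` with `m ≤ m₂` closes the bootstrap.  The hypotheses on the chain
are exactly what certified interval arithmetic delivers (lower estimates of `T'`); the conclusion for all of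
`m ∈ [m(y₀), 1)` is the conjunction over a finite cover by boxes, each with its own floor and chain. [folklore] -/
theorem noGo_box (H : Φ.Hyp y₀) {AF : State → ℝ} (hAF : Φ.AFHyp y₀ m₂ AF) {k : ℕ} {ys : ℕ → State}
    (h0 : ys 0 = y₀) (hstep : ∀ j < k, ys (j+1) ≤ Φ.T' AF (ys j)) (hfl : ∀ j ≤ k, y₀ ≤ ys j)
    (hesc : ¬ Φ.Adm m₂ (ys k)) :
    ¬ ∃ y, y₀ ≤ y ∧ (y.m ≤ m₂ ∧ Φ.Closes y) :=
  noGo_of_subiteration (T := Φ.T) (T' := Φ.T' AF) (Adm := Φ.Adm m₂) (Cl := fun y => y.m ≤ m₂ ∧ Φ.Closes y)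
    (fun _ _ hx hxy hA => T'_mono H hAF hx hxy hA) (fun _ hy hA => T'_le_T H hAF hy hA)
    (fun _ _ hx hxy hA => adm_down H hx hxy hA)
    (fun _ hy hC => ⟨adm_of_closes H hy hC.2 hC.1, T_le_of_closes hC.2⟩) h0 hstep hfl hesc

/-- VARIANT 1 (the engines' `T'`): on a box `m ≤ m₂ ≤ 7/10`, if the floor value of the lower bound `β̲_{ΣΠα}` at `o`
is `≤ 1/8` (it only decreases above the floor) and `ᾱ_F(y₀,o) ≥ 0`, the TRUE `ᾱ_F` is an admissible evaluator
(`BoundMapMonotone.afUp_mono`). [folklore] -/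
theorem AFHyp_engine (H : Φ.Hyp y₀) (hm₂ : m₂ ≤ 7 / 10) (hP : ((Φ.S y₀).inp Pt.o).piAlphaLower ≤ 1 / 8)
    (h0 : 0 ≤ Φ.exAt y₀ Pt.o 1) : Φ.AFHyp y₀ m₂ (fun y => Φ.exAt y Pt.o 1) where
  mono := by
    intro x y hx hxy hA
    have hy : y₀ ≤ y := le_trans hx hxy
    have hd1 := H.one_le_d
    have hAx := adm_down H hx hxy hA
    have Wx := wf_of_adm H hx hAx Pt.o
    have Wy := wf_of_adm H hy hA Pt.o
    have D := (H.mono hx hxy hA.stage1).inp Pt.o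
    have D0 := (H.mono le_rfl hy hA.stage1).inp Pt.o
    have hcap : ((Φ.S y).inp Pt.o).mu ≤ 7 / 10 := by rw [H.mu_eq hy]; exact hA.m_le.trans hm₂
    have hPy : ((Φ.S y).inp Pt.o).piAlphaLower ≤ 1 / 8 := D0.piAlphaLower.trans hP
    exact afUp_mono hd1 Wx Wy D hcap hPy
  le := fun _ _ _ => le_rfl
  floor_nonneg := h0

/-- VARIANT 2 (cap-free): on ANY box `m ≤ m₂ < 1` the box minorant `afUpBoxOfInputs d · P₀ m₂` with `P₀` the floor
value of `β̲_{ΣΠα}` at `o` is an admissible evaluator, provided it is `≥ 0` at the floor. [folklore] -/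
theorem AFHyp_box (H : Φ.Hyp y₀) (hm₂ : m₂ < 1)
    (h0 : 0 ≤ afUpBoxOfInputs Φ.d ((Φ.S y₀).inp Pt.o) ((Φ.S y₀).inp Pt.o).piAlphaLower m₂) :
    Φ.AFHyp y₀ m₂ (fun y => afUpBoxOfInputs Φ.d ((Φ.S y).inp Pt.o) ((Φ.S y₀).inp Pt.o).piAlphaLower m₂) where
  mono := by
    intro x y hx hxy hA
    have hy : y₀ ≤ y := le_trans hx hxy
    have hd1 := H.one_le_d
    have hAx := adm_down H hx hxy hA
    have Wx := wf_of_adm H hx hAx Pt.o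
    have Wy := wf_of_adm H hy hA Pt.o
    have D := (H.mono hx hxy hA.stage1).inp Pt.o
    exact afUpBox_mono hd1 Wx Wy D
  le := by
    intro y hy hA
    have hd1 := H.one_le_d
    have Wy := wf_of_adm H hy hA Pt.o
    have D0 := (H.mono le_rfl hy hA.stage1).inp Pt.o
    have hm : ((Φ.S y).inp Pt.o).mu ≤ m₂ := by rw [H.mu_eq hy]; exact hA.m_le
    exact afUpBox_le hd1 Wy hm hm₂ D0.piAlphaLower
  floor_nonneg := h0

/-- The two variants assembled: the ENGINE form of the certificate (what N29 certifies at `d = 10` on the box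
`m ≤ 7/10`). [folklore] -/
theorem noGo_box_engine (H : Φ.Hyp y₀) (hm₂ : m₂ ≤ 7 / 10) (hP : ((Φ.S y₀).inp Pt.o).piAlphaLower ≤ 1 / 8)
    (h0 : 0 ≤ Φ.exAt y₀ Pt.o 1) {k : ℕ} {ys : ℕ → State} (hys0 : ys 0 = y₀)
    (hstep : ∀ j < k, ys (j+1) ≤ Φ.T' (fun y => Φ.exAt y Pt.o 1) (ys j)) (hfl : ∀ j ≤ k, y₀ ≤ ys j)
    (hesc : ¬ Φ.Adm m₂ (ys k)) :
    ¬ ∃ y, y₀ ≤ y ∧ (y.m ≤ m₂ ∧ Φ.Closes y) :=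
  noGo_box H (AFHyp_engine H hm₂ hP h0) hys0 hstep hfl hesc

/-- The cap-free BOX form of the certificate (any `m₂ < 1`). [folklore] -/
theorem noGo_box_capfree (H : Φ.Hyp y₀) (hm₂ : m₂ < 1)
    (h0 : 0 ≤ afUpBoxOfInputs Φ.d ((Φ.S y₀).inp Pt.o) ((Φ.S y₀).inp Pt.o).piAlphaLower m₂)
    {k : ℕ} {ys : ℕ → State} (hys0 : ys 0 = y₀)
    (hstep : ∀ j < k, ys (j+1) ≤
      Φ.T' (fun y => afUpBoxOfInputs Φ.d ((Φ.S y).inp Pt.o) ((Φ.S y₀).inp Pt.o).piAlphaLower m₂) (ys j))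
    (hfl : ∀ j ≤ k, y₀ ≤ ys j) (hesc : ¬ Φ.Adm m₂ (ys k)) :
    ¬ ∃ y, y₀ ≤ y ∧ (y.m ≤ m₂ ∧ Φ.Closes y) :=
  noGo_box H (AFHyp_box H hm₂ h0) hys0 hstep hfl hesc

/-- The `k = 0` instance: if the floor of a box is itself inadmissible (e.g. TechCondition III / the series ratio
fails there, as on every box with `m(y₀)` close to `1`), nothing in the box closes — no chain and no evaluator
needed. [folklore] -/
theorem noGo_box_floor (H : Φ.Hyp y₀) (hesc : ¬ Φ.Adm m₂ y₀) : ¬ ∃ y, y₀ ≤ y ∧ (y.m ≤ m₂ ∧ Φ.Closes y) :=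
  fun ⟨_, hy, hm, hC⟩ => hesc (adm_down H le_rfl hy (adm_of_closes H hy hC hm))

/-- THE COVER: a global floor `y₀` and finitely many boxes `(a, b)` (floor value `a` of `m`, cap `b`) covering
`[m(y₀), 1)`; if no box contains a closing point above its own floor `y₀[m := a]`, then no `y ≥ y₀` closes at all
(`Closes` forces `m < 1`).  Each box is discharged by `noGo_box_engine` / `noGo_box_capfree` / `noGo_box_floor` with
its own floor, stage-1 hypotheses `Hyp (y₀[m := a])` and chain. [folklore] -/
theorem noGo_of_cover (boxes : List (ℝ × ℝ))
    (hcover : ∀ m : ℝ, y₀.m ≤ m → m < 1 → ∃ ab ∈ boxes, ab.1 ≤ m ∧ m ≤ ab.2)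
    (hbox : ∀ ab ∈ boxes, ¬ ∃ y, ({ y₀ with m := ab.1 } : State) ≤ y ∧ (y.m ≤ ab.2 ∧ Φ.Closes y)) :
    ¬ ∃ y, y₀ ≤ y ∧ Φ.Closes y := by
  rintro ⟨y, hy, hC⟩
  obtain ⟨ab, hab, h1, h2⟩ := hcover y.m hy.2.1 hC.m_lt_one
  exact hbox ab hab ⟨y, ⟨hy.1, h1, hy.2.2.1, hy.2.2.2⟩, h2, hC⟩

/-- A closing point has `Γ₂ > 0` (cell 56: `0 < boundF2[s] < Γ₂`) — an a-priori floor needing no hypothesis. [folklore] -/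
theorem Closes.Gamma2_pos {y : State} (hC : Φ.Closes y) : 0 < y.Gamma2 :=
  (hC.f2pos Pt.o).trans (hC.f2 Pt.o)

/-- A closing point has `c_j > boundF3[j,i]` (cell 56 at the initial point), a state-independent floor. [folklore] -/
theorem Closes.initCell_lt {y : State} (hC : Φ.Closes y) (j : Fin 6) : Φ.initCell j < y.c j :=
  hC.f3init j

/-- THE FULL CLAIM "no choice of constants closes": FLOOR DOMINANCE for the three scalar coordinates (every closing
point has `Γ₁ ≥ Γ₁(y₀)`, `m ≥ m(y₀)`, `Γ₂ ≥ Γ₂(y₀)` — a-priori bounds, HOME/MARGINS.md §6.1; for `Γ₂(y₀) ≤ 0` use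
`Closes.Gamma2_pos`), the weights' floor at or below the initial-point cells (discharged by `Closes` itself), and
the box cover of `noGo_of_cover`. [folklore] -/
theorem noGo_all (hc : ∀ j, y₀.c j ≤ Φ.initCell j)
    (hdom : ∀ y, Φ.Closes y → y₀.Gamma1 ≤ y.Gamma1 ∧ y₀.m ≤ y.m ∧ y₀.Gamma2 ≤ y.Gamma2)
    (boxes : List (ℝ × ℝ)) (hcover : ∀ m : ℝ, y₀.m ≤ m → m < 1 → ∃ ab ∈ boxes, ab.1 ≤ m ∧ m ≤ ab.2)
    (hbox : ∀ ab ∈ boxes, ¬ ∃ y, ({ y₀ with m := ab.1 } : State) ≤ y ∧ (y.m ≤ ab.2 ∧ Φ.Closes y)) :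
    ¬ ∃ y, Φ.Closes y := by
  rintro ⟨y, hC⟩
  have h := hdom y hC
  exact noGo_of_cover boxes hcover hbox
    ⟨y, ⟨h.1, h.2.1, h.2.2, fun j => (hc j).trans (hC.f3init j).le⟩, hC⟩

/-- Floor dominance is AUTOMATIC for the standard floor: every closing point has `Γ₁ > 1`, `m > 0`, `Γ₂ > 1`
([NoBLE17] Lemma 2.1 and `c_μ > 0`, fields of `Closes`) and `c_j > boundF3[j,i]`.  Hence for any floor `y₀` with
`Γ₁(y₀) ≤ 1`, `m(y₀) ≤ 0`, `Γ₂(y₀) ≤ 1`, `c(y₀) ≤ initCell`, a box cover of `[m(y₀), 1)` whose boxes are all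
discharged proves that NO tuple closes — with no dominance hypothesis left over.
[cite: FitznerVanDerHofstad2016NoBLE, Lemma 2.1 (Bootstrap argument), arXiv p. 10; (2.20) and the line after it (`c_μ > 1`)] -/
theorem noGo_all_std (hG1 : y₀.Gamma1 ≤ 1) (hm : y₀.m ≤ 0) (hG2 : y₀.Gamma2 ≤ 1)
    (hc : ∀ j, y₀.c j ≤ Φ.initCell j)
    (boxes : List (ℝ × ℝ)) (hcover : ∀ m : ℝ, y₀.m ≤ m → m < 1 → ∃ ab ∈ boxes, ab.1 ≤ m ∧ m ≤ ab.2)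
    (hbox : ∀ ab ∈ boxes, ¬ ∃ y, ({ y₀ with m := ab.1 } : State) ≤ y ∧ (y.m ≤ ab.2 ∧ Φ.Closes y)) :
    ¬ ∃ y, Φ.Closes y :=
  noGo_all hc (fun _ hC => ⟨hG1.trans hC.one_lt_Gamma1.le, hm.trans hC.m_pos.le, hG2.trans hC.one_lt_Gamma2.le⟩)
    boxes hcover hbox

/-- The same with the floor written out: `y₀ = (1, 0, 1, c₀)` with `c₀ ≤ initCell`. [folklore] -/
theorem noGo_all_floor (c₀ : Fin 6 → ℝ) (hc : ∀ j, c₀ j ≤ Φ.initCell j)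
    (boxes : List (ℝ × ℝ)) (hcover : ∀ m : ℝ, 0 ≤ m → m < 1 → ∃ ab ∈ boxes, ab.1 ≤ m ∧ m ≤ ab.2)
    (hbox : ∀ ab ∈ boxes, ¬ ∃ y,
      ({ Gamma1 := 1, m := ab.1, Gamma2 := 1, c := c₀ } : State) ≤ y ∧ (y.m ≤ ab.2 ∧ Φ.Closes y)) :
    ¬ ∃ y, Φ.Closes y :=
  noGo_all_std (y₀ := { Gamma1 := 1, m := 0, Gamma2 := 1, c := c₀ }) le_rfl le_rfl le_rfl hc boxes hcover hbox

end Proofs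

end Frame

end NoGoFrame
end Literature.Probability.FitznerVanDerHofstad2017
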